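import Literature.AlgebraicGeometry.Shioda1982.HodgeQuadruplesTwoThreePower
import HarnessLib

/-!
# Hodge quadruples of the Fermat surface at the levels `m = 2·3ᵇ`: the `Λ`-relation and the shape of a quadruple with a unit

Topic `Literature/AlgebraicGeometry/Shioda1982`. THEOREMS only (no definition of record, no named fact, no `sorry`).
Seventh file of the series treating [Aoki1983, Thm. C] = [AokiShioda1983, Thm. (𝔅²ₘ) (ii)] = [Shioda1982PicardFermat,
Prop. 4 (Q′)] at the levels `m = 2ᵃ3ᵇ` without a prime factor `≥ 5`: the EDGE FAMILY **`a = 1`, `m = 2·3ᵇ`**. Here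
`m = 6n` with `n = 3ᵏ` ODD (`k = b − 1`), `𝔥 = 3n = m/2` is odd and `𝔯 = 2n = m/3 ≡ 0 (mod 3)`: the four-point functional
`Φ_y` of parts I/V (built on the shift by `𝔥`) is useless (it mixes parities), and the class relation of part I is void
(the odd part `o` restricted to units satisfies no linear relation at all: `α_x` has a single unit member). The replacement:

* **`countSub_lambda_twiceThreePow`** (the `Λ`-RELATION, `k ≥ 1`): for a Hodge multiset `s` over `ℤ/m` and a unit `z`,
  with `o(w) = #_w s − #_{−w} s` and **`Λ(z) = o(z) + o(2z) − o(2z + 3n)`: `Λ(z) = Λ(z + 2n)`** (`Λ` is constant on the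
  classes `{z, z + 2n, z + 4n}` of units modulo `2n`). PROOF: with `Θ_y(g) = g(y) − g(−y) − g(y + 2n) + g(−(y + 2n))` the
  functional `Θ_z − Θ_{2z+4n} + Θ_{2z+n}` kills every Koblitz–Ogus vector `D_{M,z′}`: a divisor `M` of `2·3ᵏ⁺¹` divides `2n`
  (each `Θ` kills the congruence part; the point `(m/M)z′` is a multiple of `3`, the twelve points are prime to `3`), or
  `M = 3n` (the point `2z′` is even and is seen only by `Θ_{2z+4n}`, exactly as `−Θ_z` sees the congruence class of `z′`
  (`2z′ = 2t ⟺ z′ ≡ t (mod 3n)`), while the congruence parts of `Θ_{2z+4n}` and `Θ_{2z+n}` agree (`2z + 4n ≡ 2z + n`)), or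
  `M = m`. (`lambda_class_twiceThreePow`: the two identities of a class in normal form.)
* **`shape_of_unit_twiceThreePow`** (`k ≥ 3`, i.e. `m ≥ 162`): in a PAIR-FREE Hodge `4`-multiset `s` over `ℤ/m` a
  unit member `y` forces `s ∈ {γ_y, α_y, β_y, β_x}` where `2x = y + 3n` (`γ_y = {y, y+2n, y+4n, −3y}`,
  `α_y = {y, y+3n, −2y, 3n}`, `β_y = {y, y+3n, 2y+3n, −4y}`, and `y = 2x + 3n` is the second unit of `β_x`). PROOF (this
  formalisation's): the `Λ`-identities of the classes of `x`, `y` and `2y + 3n` (the map `z ↦ 2z + 3n` permutes the classes;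
  modulo `n` it is `Y ↦ 2Y`, so the hexagons `±x + nℤ`, `±y + nℤ`, `±2y + nℤ`, `±4y + nℤ` carrying them are pairwise disjoint
  once `27 ∣ n`, `pt4₇_injective`) and `#_y ≥ 1 = 1 + #_{−y}` involve the multiplicities of `s = {y, t₁, t₂, t₃}` at these `48`
  points only through the TYPES of `t₁, t₂, t₃` (which of the `48` points, or none: `count_P48`); the `49³` type
  configurations are decided by the kernel (`stmtA_all`, `decide +kernel`): `17` cores survive (`core_of_unit₇`), and the zero
  sum keeps exactly the four standard ones (`shape_of_unit₇`: the other `13` force `c·y + j·n = 0` or `3(c·y + j·n) = 0` with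
  `3 ∤ c`, impossible modulo `3`, or equate an odd residue with an even one).
* **`evens_of_noUnit_twiceThreePow`**: if `s` has no unit member then with every even member `e` prime to `3` also
  `e + 2n, e + 4n ∈ s` (for units `z`, `Λ(z) = o(2z)` is then constant on classes).

Cross-checks outside Lean (cell `pub-hfermat`, `g39-session/towers/edgeA/`): brute force over all Hodge `4`-multisets at
`m = 18, 54, 162` (`81, 462, 3549` multisets): the `Λ`-relation holds for every unit (`0` violations); at `54` and `162` the
relations `Λ(z) = Λ(z + 2n)` together with pair-freeness and the zero sum characterise EXACTLY the Hodge quadruples with an odd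
member and a member prime to `3` (`42/42`, `126/126`, `test_E.py`); the `17` cores and the `210` ordered type configurations
satisfying `hypA` were cross-checked in Python (`gen_tree.py`, `gen_abstract.py`).

HONEST FRAMING (cell `pub-hfermat`): explicit algebraic cycles for specific Hodge classes on Fermat/Delsarte varieties; residual
open instances listed; no claim on general Hodge. (Surface classes are algebraic by Lefschetz (1,1); this file proves count
identities for Shioda's Hodge condition towards a printed structure theorem; no cycle is constructed here.)

## References
* [Aoki1983] N. Aoki, *On some arithmetic problems related to the Hodge cycles on the Fermat varieties*, Math. Ann. 266
  (1983) 23–54 — Thm. C p. 47, Prop. 2.2, Thm. D.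
* [AokiShioda1983] N. Aoki, T. Shioda, *Generators of the Néron–Severi group of a Fermat surface*, Progr. Math. 35 (1983)
  1–12 — §2 Thm. (𝔅²ₘ) (ii).
* [Shioda1982PicardFermat] T. Shioda, *On the Picard number of a Fermat surface*, J. Fac. Sci. Univ. Tokyo IA 28 (1982)
  725–734 — Lemma 1, Prop. 4 (Q′) p. 729.
* [Deligne1982HodgeCycles] P. Deligne, *Hodge cycles on abelian varieties*, LNM 900 (1982), Rem. 7.16 (a) (Koblitz–Ogus);
  through the tree's `KoblitzOgus.hodge_eq_combination`.
* [MeyerNeutsch1981Fermatquadrupel] W. Meyer, W. Neutsch, *Fermatquadrupel*, Math. Ann. 256 (1981) 51–62 — Tabelle 1 p. 54.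
* [Shioda1979PJA] T. Shioda, Proc. Japan Acad. 55A (1979) 111–114, §1 (2), (3) (the Hodge condition `IsHodgeMultiset`).
-/

namespace Literature.AlgebraicGeometry.Shioda1982

open Finset Multiset
open Literature.AlgebraicGeometry.HodgeTheory Literature.AlgebraicGeometry.HodgeTheory.FermatCharacter

section TwiceThreePow

variable {m n k : ℕ} [NeZero m]

/-- `𝔥 = 3n = m/2` as a residue modulo `m = 6n`. -/
local notation "𝔥" => (((3 * n : ℕ)) : ZMod m)
/-- `𝔯 = 2n = m/3` as a residue modulo `m = 6n`. -/
local notation "𝔯" => (((2 * n : ℕ)) : ZMod m)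
/-- `𝔫 = n = m/6` as a residue modulo `m = 6n`. -/
local notation "𝔫" => (((n : ℕ)) : ZMod m)
/-- `o(w) = #_w s − #_{−w} s`, the odd part of the multiplicity function of `s`. -/
local notation "𝔬[" s ", " w "]" => ((Multiset.count w s : ℤ) - Multiset.count (-w) s)

/-! ### The level `m = 6n = 2·3ᵏ⁺¹`: elementary facts -/

omit [NeZero m] in
/-- `0 < n`. [folklore] -/
private theorem n_pos₇ (hn : n = 3 ^ k) : 0 < n := by
  rw [hn]; positivity

omit [NeZero m] in
/-- `3 ∣ n` when `k ≥ 1`. [folklore] -/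
private theorem three_dvd_n₇ (hn : n = 3 ^ k) (hk : 1 ≤ k) : 3 ∣ n := by
  obtain ⟨k', rfl⟩ := Nat.exists_eq_add_of_le' hk
  exact ⟨3 ^ k', by rw [hn]; ring⟩

omit [NeZero m] in
/-- `n` is odd. [folklore] -/
private theorem not_two_dvd_n₇ (hn : n = 3 ^ k) : ¬ 2 ∣ n := by
  rw [hn]
  intro h
  have := Nat.Prime.dvd_of_dvd_pow Nat.prime_two h
  omega

omit [NeZero m] in
/-- `3n + 3n = 0` in `ℤ/6n`. [folklore] -/
private theorem h_add_h₇ (hm : m = 6 * n) : 𝔥 + 𝔥 = 0 := by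
  have e : (((3 * n : ℕ) : ZMod m)) + ((3 * n : ℕ) : ZMod m) = ((m : ℕ) : ZMod m) := by
    push_cast; rw [hm]; push_cast; ring
  rw [e, ZMod.natCast_self]

omit [NeZero m] in
/-- `−3n = 3n`. [folklore] -/
private theorem neg_h₇ (hm : m = 6 * n) : -𝔥 = 𝔥 := by
  linear_combination -(h_add_h₇ hm)

omit [NeZero m] in
/-- `⟨3n⟩ = 3n`. [folklore] -/
private theorem val_h₇ (hm : m = 6 * n) (hn0 : 0 < n) : (𝔥 : ZMod m).val = 3 * n := by
  rw [ZMod.val_natCast, Nat.mod_eq_of_lt (by omega)]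

omit [NeZero m] in
/-- `⟨2n⟩ = 2n`. [folklore] -/
private theorem val_r₇ (hm : m = 6 * n) (hn0 : 0 < n) : (𝔯 : ZMod m).val = 2 * n := by
  rw [ZMod.val_natCast, Nat.mod_eq_of_lt (by omega)]

omit [NeZero m] in
/-- `⟨n⟩ = n`. [folklore] -/
private theorem val_n₇ (hm : m = 6 * n) (hn0 : 0 < n) : (𝔫 : ZMod m).val = n := by
  rw [ZMod.val_natCast, Nat.mod_eq_of_lt (by omega)]

omit [NeZero m] in
/-- `3n = 3·n`, `2n = 2·n` as residues. [folklore] -/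
private theorem h_eq_three_mul₇ : (𝔥 : ZMod m) = 3 * 𝔫 ∧ (𝔯 : ZMod m) = 2 * 𝔫 := by
  constructor <;> push_cast <;> ring

omit [NeZero m] in
/-- `6·n = 0` in `ℤ/6n`. [folklore] -/
private theorem six_mul_n₇ (hm : m = 6 * n) : (6 : ZMod m) * 𝔫 = 0 := by
  have e : (6 : ZMod m) * ((n : ℕ) : ZMod m) = ((m : ℕ) : ZMod m) := by rw [hm]; push_cast; ring
  rw [e, ZMod.natCast_self]

/-- Adding a multiple of `M` does not change the residue mod `M` (`M ∣ m`). [folklore] -/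
private theorem mod_add_of_dvd₇ {M : ℕ} (hM : M ∣ m) (x : ZMod m) {c : ZMod m} (hc : M ∣ c.val) :
    (x + c).val % M = x.val % M := by
  obtain ⟨t, ht⟩ := hc
  rw [ZMod.val_add, Nat.mod_mod_of_dvd _ hM, ht, Nat.add_mul_mod_self_left]

/-- `x ≡ x' (mod M)` is stable under adding a constant (`M ∣ m`). [folklore] -/
private theorem mod_congr_add₇ {M : ℕ} (hM : M ∣ m) {x x' : ZMod m} (h : x.val % M = x'.val % M) (c : ZMod m) :
    (x + c).val % M = (x' + c).val % M := by
  rw [ZMod.val_add, ZMod.val_add, Nat.mod_mod_of_dvd _ hM, Nat.mod_mod_of_dvd _ hM, Nat.add_mod, h, ← Nat.add_mod]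

/-- `x ≡ x' (mod M)` iff the reductions mod `M` agree. [folklore] -/
private theorem castHom_eq_iff₇ {M : ℕ} (hM : M ∣ m) {x x' : ZMod m} :
    (ZMod.castHom hM (ZMod M)) x = (ZMod.castHom hM (ZMod M)) x' ↔ x.val % M = x'.val % M := by
  rw [ZMod.castHom_apply, ZMod.castHom_apply, ZMod.cast_eq_val, ZMod.cast_eq_val, ZMod.natCast_eq_natCast_iff']

/-- `x ≡ x' (mod M)` is stable under negation (`M ∣ m`). [folklore] -/
private theorem mod_congr_neg₇ {M : ℕ} (hM : M ∣ m) {x x' : ZMod m} (h : x.val % M = x'.val % M) :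
    (-x).val % M = (-x').val % M := by
  rw [← castHom_eq_iff₇ hM] at h ⊢
  rw [map_neg, map_neg, h]

/-- `p ∣ ⟨x⟩` iff `x` reduces to `0` modulo `p` (`p ∣ m`). [folklore] -/
private theorem dvd_val_iff_cast₇ {p : ℕ} (hp : p ∣ m) (x : ZMod m) : p ∣ x.val ↔ ZMod.castHom hp (ZMod p) x = 0 := by
  rw [ZMod.castHom_apply, ZMod.cast_eq_val, ZMod.natCast_eq_zero_iff]

/-- A divisor `p` of `m` divides `⟨−x⟩` iff it divides `⟨x⟩`. [folklore] -/
private theorem dvd_val_neg_iff₇ {p : ℕ} (hp : p ∣ m) (x : ZMod m) : p ∣ (-x).val ↔ p ∣ x.val := by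
  rw [dvd_val_iff_cast₇ hp, dvd_val_iff_cast₇ hp, map_neg, neg_eq_zero]

/-- A divisor `p` of `m` dividing `⟨c⟩` divides `⟨x + c⟩` iff it divides `⟨x⟩`. [folklore] -/
private theorem dvd_val_add_iff₇ {p : ℕ} (hp : p ∣ m) (x : ZMod m) {c : ZMod m} (hc : p ∣ c.val) :
    p ∣ (x + c).val ↔ p ∣ x.val := by
  rw [Nat.dvd_iff_mod_eq_zero, Nat.dvd_iff_mod_eq_zero, mod_add_of_dvd₇ hp x hc]

omit [NeZero m] in
/-- `2 ∣ m`. [folklore] -/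
private theorem two_dvd_m₇ (hm : m = 6 * n) : 2 ∣ m := ⟨3 * n, by rw [hm]; ring⟩

omit [NeZero m] in
/-- `3 ∣ m`. [folklore] -/
private theorem three_dvd_m₇ (hm : m = 6 * n) : 3 ∣ m := ⟨2 * n, by rw [hm]; ring⟩

omit [NeZero m] in
/-- `3 ∣ ⟨j·n⟩` (`3 ∣ n`). [folklore] -/
private theorem three_dvd_val_mul_n₇ (hm : m = 6 * n) (h3 : 3 ∣ n) (j : ℕ) : 3 ∣ (((j : ℕ) : ZMod m) * 𝔫).val := by
  rw [show ((j : ℕ) : ZMod m) * 𝔫 = ((j * n : ℕ) : ZMod m) by push_cast; ring, ZMod.val_natCast]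
  exact (Nat.dvd_mod_iff (three_dvd_m₇ hm)).mpr (Dvd.dvd.mul_left h3 j)

/-- `y + j·n` is prime to `3` when `y` is (`3 ∣ n`). [folklore] -/
private theorem prime_three_add_mul_n₇ (hm : m = 6 * n) (h3 : 3 ∣ n) {y : ZMod m} (hy3 : ¬ 3 ∣ y.val) (j : ℕ) :
    ¬ 3 ∣ (y + ((j : ℕ) : ZMod m) * 𝔫).val := by
  rwa [dvd_val_add_iff₇ (three_dvd_m₇ hm) y (three_dvd_val_mul_n₇ hm h3 j)]

/-- The points `−y, y + 2n, −(y + 2n)` attached to a `y` prime to `3` are prime to `3` (`3 ∣ n`). [folklore] -/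
private theorem prime_three_points₇ (hm : m = 6 * n) (h3 : 3 ∣ n) {y : ZMod m} (hy3 : ¬ 3 ∣ y.val) :
    ¬ 3 ∣ (-y).val ∧ ¬ 3 ∣ (y + 𝔯).val ∧ ¬ 3 ∣ (-(y + 𝔯)).val := by
  have a3 : ¬ 3 ∣ (y + 𝔯).val := by
    have := prime_three_add_mul_n₇ hm h3 hy3 2
    rwa [h_eq_three_mul₇.2]
  exact ⟨by rwa [dvd_val_neg_iff₇ (three_dvd_m₇ hm)], a3, by rwa [dvd_val_neg_iff₇ (three_dvd_m₇ hm)]⟩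

/-- The points `−y, y + 2n, −(y + 2n)` attached to an odd `y` are odd. [folklore] -/
private theorem odd_points₇ (hm : m = 6 * n) (hn0 : 0 < n) {y : ZMod m} (hy : ¬ 2 ∣ y.val) :
    ¬ 2 ∣ (-y).val ∧ ¬ 2 ∣ (y + 𝔯).val ∧ ¬ 2 ∣ (-(y + 𝔯)).val := by
  have h2r : 2 ∣ (𝔯 : ZMod m).val := by rw [val_r₇ hm hn0]; exact Dvd.intro n rfl
  have a2 : ¬ 2 ∣ (y + 𝔯).val := by rwa [dvd_val_add_iff₇ (two_dvd_m₇ hm) y h2r]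
  exact ⟨by rwa [dvd_val_neg_iff₇ (two_dvd_m₇ hm)], a2, by rwa [dvd_val_neg_iff₇ (two_dvd_m₇ hm)]⟩

/-- `⟨2z⟩` is even (`m` even). [folklore] -/
private theorem two_dvd_val_two_mul₇ (hm : m = 6 * n) (z : ZMod m) : 2 ∣ ((2 : ZMod m) * z).val := by
  rw [show (2 : ZMod m) * z = (((2 * z.val : ℕ)) : ZMod m) by push_cast; rw [ZMod.natCast_zmod_val], ZMod.val_natCast]
  exact (Nat.dvd_mod_iff (two_dvd_m₇ hm)).mpr (Dvd.intro _ rfl)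

omit [NeZero m] in
/-- The divisors of `m = 2·3ᵏ⁺¹`: each divides `2n = m/3`, or equals `3n = m/2`, or equals `m`. [folklore] -/
private theorem dvd_cases₇ (hm : m = 6 * n) (hn : n = 3 ^ k) {M : ℕ} (hM : M ∣ m) :
    M ∣ 2 * n ∨ M = 3 * n ∨ M = m := by
  rw [hm, hn, show 6 * 3 ^ k = 2 ^ 1 * 3 ^ (k + 1) by ring] at hM
  obtain ⟨a, b, ha, hb, rfl⟩ := Nat.dvd_mul.mp hM
  obtain ⟨s, hs, rfl⟩ := (Nat.dvd_prime_pow Nat.prime_two).mp ha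
  obtain ⟨t, ht, rfl⟩ := (Nat.dvd_prime_pow Nat.prime_three).mp hb
  by_cases ht' : t ≤ k
  · left
    rw [show 2 * n = 2 ^ 1 * 3 ^ k by rw [hn]; ring]
    exact Nat.mul_dvd_mul (pow_dvd_pow 2 hs) (pow_dvd_pow 3 ht')
  · have htk : t = k + 1 := by omega
    subst htk
    interval_cases s
    · right; left
      rw [hn]; ring
    · right; right
      rw [hm, hn]; ring

/-! ### The functional `Θ_y(g) = g(y) − g(−y) − g(y + 2n) + g(−(y + 2n))` and the Koblitz–Ogus vectors -/

variable (n) in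
/-- The four-point functional `Θ_y(g) = g(y) − g(−y) − g(y + 2n) + g(−(y + 2n))` on functions on `ℤ/6n`. [folklore] -/
private def theta₇ (y : ZMod m) (g : ZMod m → ℚ) : ℚ :=
  g y - g (-y) - g (y + 𝔯) + g (-(y + 𝔯))

omit [NeZero m] in
/-- `Θ_y` is additive. [folklore] -/
private theorem theta₇_add (y : ZMod m) (g g' : ZMod m → ℚ) :
    theta₇ n y (fun w ↦ g w + g' w) = theta₇ n y g + theta₇ n y g' := by
  simp only [theta₇]
  ring

omit [NeZero m] in
/-- `Θ_y` is homogeneous. [folklore] -/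
private theorem theta₇_mul (y : ZMod m) (c : ℚ) (g : ZMod m → ℚ) :
    theta₇ n y (fun w ↦ c * g w) = c * theta₇ n y g := by
  simp only [theta₇]
  ring

omit [NeZero m] in
/-- `Θ_y` commutes with finite sums. [folklore] -/
private theorem theta₇_sum (y : ZMod m) {ι : Type*} (t : Finset ι) (g : ι → ZMod m → ℚ) :
    theta₇ n y (fun w ↦ ∑ j ∈ t, g j w) = ∑ j ∈ t, theta₇ n y (g j) := by
  simp only [theta₇, Finset.sum_add_distrib, Finset.sum_sub_distrib]

omit [NeZero m] in
/-- `Θ_y` kills negation-invariant functions. [folklore] -/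
private theorem theta₇_eq_zero_of_even (y : ZMod m) {g : ZMod m → ℚ} (hg : ∀ w, g (-w) = g w) :
    theta₇ n y g = 0 := by
  simp only [theta₇, hg]
  ring

/-- The Koblitz–Ogus distribution vector of level `M ∣ m` through `z`: `w ↦ [w ≡ z (mod M)] − [(m/M)·z = w]`.
[cite: Deligne1982HodgeCycles, Rem. 7.16 (a)] -/
private def koD₇ (m : ℕ) (M : ℕ) (z w : ZMod m) : ℚ :=
  (if w.val % M = z.val % M then (1 : ℚ) else 0) - (if ((m / M : ℕ) : ZMod m) * z = w then 1 else 0)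

omit [NeZero m] in
/-- **A point mass at a point with a divisor `p ∣ m` is invisible to `Θ_y`** when the four points of `Θ_y` are prime to `p`.
[folklore] -/
private theorem theta₇_point_dvd {p : ℕ} {y w : ZMod m} (hw : p ∣ w.val) (h₀ : ¬ p ∣ y.val) (h₁ : ¬ p ∣ (-y).val)
    (h₂ : ¬ p ∣ (y + 𝔯).val) (h₃ : ¬ p ∣ (-(y + 𝔯)).val) :
    theta₇ n y (fun v ↦ if w = v then (1 : ℚ) else 0) = 0 := by
  have ne : ∀ v : ZMod m, ¬ p ∣ v.val → w ≠ v := by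
    rintro v hv rfl
    exact hv hw
  simp only [theta₇, if_neg (ne y h₀), if_neg (ne _ h₁), if_neg (ne _ h₂), if_neg (ne _ h₃)]
  ring

/-- The congruence indicator `[· ≡ z (mod M)]` is killed by `Θ_y` for every `M ∣ 2n`. [folklore] -/
private theorem theta₇_congr_eq_zero (hm : m = 6 * n) (hn0 : 0 < n) (y z : ZMod m) {M : ℕ} (hM : M ∣ 2 * n) :
    theta₇ n y (fun v ↦ if v.val % M = z.val % M then (1 : ℚ) else 0) = 0 := by
  have hMm : M ∣ m := Nat.dvd_trans hM ⟨3, by rw [hm]; ring⟩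
  have hc : M ∣ (𝔯 : ZMod m).val := by rw [val_r₇ hm hn0]; exact hM
  have hneg : -(𝔯 : ZMod m) = (((4 * n : ℕ)) : ZMod m) := by
    have e : (𝔯 : ZMod m) + (((4 * n : ℕ)) : ZMod m) = ((m : ℕ) : ZMod m) := by push_cast; rw [hm]; push_cast; ring
    rw [ZMod.natCast_self] at e
    linear_combination -e
  have hc' : M ∣ ((((4 * n : ℕ)) : ZMod m)).val := by
    rw [ZMod.val_natCast, Nat.mod_eq_of_lt (by omega)]
    exact dvd_trans hM ⟨2, by ring⟩
  have e3 : -(y + 𝔯) = -y + (((4 * n : ℕ)) : ZMod m) := by rw [neg_add, hneg]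
  simp only [theta₇, e3, mod_add_of_dvd₇ hMm _ hc, mod_add_of_dvd₇ hMm _ hc']
  ring

/-- The congruence indicator modulo `M ∣ m` is seen by `Θ_y` only through the class of `y` modulo `M`. [folklore] -/
private theorem theta₇_congr_M {M : ℕ} (hM : M ∣ m) {y y' : ZMod m} (hyy' : y.val % M = y'.val % M) (z : ZMod m) :
    theta₇ n y (fun v ↦ if v.val % M = z.val % M then (1 : ℚ) else 0) =
      theta₇ n y' (fun v ↦ if v.val % M = z.val % M then (1 : ℚ) else 0) := by
  have a1 : (-y).val % M = (-y').val % M := mod_congr_neg₇ hM hyy'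
  have a2 : (y + 𝔯).val % M = (y' + 𝔯).val % M := mod_congr_add₇ hM hyy' _
  have a3 : (-(y + 𝔯)).val % M = (-(y' + 𝔯)).val % M := mod_congr_neg₇ hM a2
  simp only [theta₇, hyy', a1, a2, a3]

/-- The distribution vector of level `m` is zero. [folklore] -/
private theorem koD₇_self (z w : ZMod m) : koD₇ m m z w = 0 := by
  have hm0 : m ≠ 0 := NeZero.ne m
  simp only [koD₇, Nat.mod_eq_of_lt (ZMod.val_lt _), Nat.div_self (Nat.pos_of_ne_zero hm0), Nat.cast_one, one_mul]
  by_cases hzw : w = z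
  · rw [if_pos (by rw [hzw]), if_pos hzw.symm, sub_self]
  · rw [if_neg (fun e ↦ hzw (ZMod.val_injective _ e)), if_neg (fun e ↦ hzw e.symm), sub_self]

/-- The point `(m/M)·z` of `D_{M,z}` has `p ∣ ⟨(m/M)z⟩` whenever `M ∣ m/p` (`p ∣ m`). [folklore] -/
private theorem point_dvd₇ {p M : ℕ} (hp : 0 < p) (hpm : p ∣ m) (hM : M ∣ m / p) (hM0 : 0 < M) (z : ZMod m) :
    p ∣ ((((m / M : ℕ)) : ZMod m) * z).val := by
  obtain ⟨c, hc⟩ := hM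
  obtain ⟨e, he⟩ := hpm
  have hmM : m / M = p * c := by
    rw [he, Nat.mul_div_cancel_left _ hp] at hc
    rw [he, hc, show p * (M * c) = M * (p * c) by ring, Nat.mul_div_cancel_left _ hM0]
  rw [hmM, show ((((p * c : ℕ)) : ZMod m)) * z = (((p * (c * z.val) : ℕ)) : ZMod m) by
    push_cast; rw [ZMod.natCast_zmod_val]; ring, ZMod.val_natCast]
  exact (Nat.dvd_mod_iff ⟨e, he⟩).mpr (Dvd.intro _ rfl)

/-- **`2z = 2t ⟺ z ≡ t (mod 3n)`** in `ℤ/6n`. [folklore] -/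
private theorem two_mul_eq_iff₇ (hm : m = 6 * n) (z t : ZMod m) :
    (2 : ZMod m) * z = 2 * t ↔ z.val % (3 * n) = t.val % (3 * n) := by
  have h3n : 3 * n ∣ m := ⟨2, by rw [hm]; ring⟩
  rw [← castHom_eq_iff₇ h3n, ← sub_eq_zero, ← mul_sub, ← sub_eq_zero (a := ZMod.castHom h3n _ z), ← map_sub]
  set w := z - t
  rw [show (2 : ZMod m) * w = (((2 * w.val : ℕ)) : ZMod m) by push_cast; rw [ZMod.natCast_zmod_val],
    ZMod.natCast_eq_zero_iff, ZMod.castHom_apply, ZMod.cast_eq_val, ZMod.natCast_eq_zero_iff]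
  have hm' : 2 * (3 * n) ∣ m := ⟨1, by rw [hm]; ring⟩
  have hm'' : m ∣ 2 * (3 * n) := ⟨1, by rw [hm]; ring⟩
  constructor
  · intro h
    exact (Nat.mul_dvd_mul_iff_left two_pos).mp (dvd_trans hm' h)
  · intro h
    exact dvd_trans hm'' (Nat.mul_dvd_mul_left 2 h)


/-- `2z` is prime to `3` when `z` is. [folklore] -/
private theorem prime_three_two_mul₇ (hm : m = 6 * n) {z : ZMod m} (hz3 : ¬ 3 ∣ z.val) : ¬ 3 ∣ ((2 : ZMod m) * z).val := by
  rw [show (2 : ZMod m) * z = (((2 * z.val : ℕ)) : ZMod m) by push_cast; rw [ZMod.natCast_zmod_val], ZMod.val_natCast,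
    Nat.dvd_mod_iff (three_dvd_m₇ hm)]
  intro h
  exact hz3 ((Nat.Prime.dvd_mul Nat.prime_three).mp h |>.resolve_left (by norm_num))

/-- A half `x` of `y + 3n` (`2x = y + 3n`) is prime to `3` when `y` is (`3 ∣ n`). [folklore] -/
private theorem prime_three_half₇ (hm : m = 6 * n) (h3 : 3 ∣ n) {x y : ZMod m} (hy3 : ¬ 3 ∣ y.val)
    (hx : 2 * x = y + 3 * 𝔫) : ¬ 3 ∣ x.val := by
  intro h
  apply hy3
  have : 3 ∣ ((2 : ZMod m) * x).val := by
    rw [show (2 : ZMod m) * x = (((2 * x.val : ℕ)) : ZMod m) by push_cast; rw [ZMod.natCast_zmod_val],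
      ZMod.val_natCast, Nat.dvd_mod_iff (three_dvd_m₇ hm)]
    exact Dvd.dvd.mul_left h 2
  rw [hx] at this
  rwa [dvd_val_add_iff₇ (three_dvd_m₇ hm) y (by simpa using three_dvd_val_mul_n₇ hm h3 3)] at this

/-- `2z + j·n` is odd for odd `j` (`n` odd). [folklore] -/
private theorem odd_two_mul_add₇ (hm : m = 6 * n) (hn : n = 3 ^ k) (z : ZMod m) {j : ℕ} (hj : ¬ 2 ∣ j) :
    ¬ 2 ∣ (2 * z + ((j : ℕ) : ZMod m) * 𝔫).val := by
  have h2m := two_dvd_m₇ hm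
  rw [dvd_val_iff_cast₇ h2m, _root_.map_add, _root_.map_mul, _root_.map_mul, map_ofNat, map_natCast, map_natCast,
    show (2 : ZMod 2) = 0 from rfl, zero_mul, zero_add, ← Nat.cast_mul, ZMod.natCast_eq_zero_iff]
  intro h
  rcases (Nat.Prime.dvd_mul Nat.prime_two).mp h with h | h
  · exact hj h
  · exact not_two_dvd_n₇ hn h

/-- **`Θ_y` kills `D_{M,z′}` for `M ∣ 2n`** when `y` is prime to `3` (`3 ∣ n`): the congruence part is `2n`-periodic, the
point `(m/M)z′` is a multiple of `3`. [folklore] -/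
private theorem theta₇_koD_of_dvd (hm : m = 6 * n) (hn : n = 3 ^ k) (hk : 1 ≤ k) {M : ℕ} (hM : M ∈ m.divisors)
    (hM2 : M ∣ 2 * n) {y : ZMod m} (hy3 : ¬ 3 ∣ y.val) (z : ZMod m) : theta₇ n y (koD₇ m M z) = 0 := by
  have hn0 : 0 < n := n_pos₇ hn
  have h3 := three_dvd_n₇ hn hk
  have hM0 : 0 < M := Nat.pos_of_mem_divisors hM
  obtain ⟨a3, b3, c3⟩ := prime_three_points₇ hm h3 hy3
  have split : theta₇ n y (koD₇ m M z) =
      theta₇ n y (fun v ↦ if v.val % M = z.val % M then (1 : ℚ) else 0) -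
        theta₇ n y (fun v ↦ if ((m / M : ℕ) : ZMod m) * z = v then (1 : ℚ) else 0) := by
    simp only [theta₇, koD₇]
    ring
  have hw : 3 ∣ ((((m / M : ℕ)) : ZMod m) * z).val :=
    point_dvd₇ three_pos (three_dvd_m₇ hm)
      (by rwa [hm, show 6 * n = 3 * (2 * n) by ring, Nat.mul_div_cancel_left _ three_pos]) hM0 z
  rw [split, theta₇_congr_eq_zero hm hn0 y z hM2, theta₇_point_dvd hw hy3 a3 b3 c3, sub_self]

/-- **The point `2z′` is seen by `Θ_{2z+4n}` exactly as `−Θ_z` sees the congruence class of `z′` modulo `3n`**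
(`2z + 4n = 2(z + 2n)`, `2z + 4n + 2n = 2z`; `2z′ = 2t ⟺ z′ ≡ t (mod 3n)`). [folklore] -/
private theorem theta₇_point_double (hm : m = 6 * n) (z z' : ZMod m) :
    theta₇ n (2 * z + 4 * 𝔫) (fun v ↦ if (2 : ZMod m) * z' = v then (1 : ℚ) else 0) =
      -theta₇ n z (fun v ↦ if v.val % (3 * n) = z'.val % (3 * n) then (1 : ℚ) else 0) := by
  obtain ⟨-, er⟩ := h_eq_three_mul₇ (m := m) (n := n)
  have h6 := six_mul_n₇ hm
  have p1 : (2 : ZMod m) * z + 4 * 𝔫 = 2 * (z + 𝔯) := by rw [er]; ring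
  have p2 : -((2 : ZMod m) * z + 4 * 𝔫) = 2 * (-(z + 𝔯)) := by rw [er]; ring
  have p3 : (2 : ZMod m) * z + 4 * 𝔫 + 𝔯 = 2 * z := by rw [er]; linear_combination h6
  have p4 : -((2 : ZMod m) * z + 4 * 𝔫 + 𝔯) = 2 * (-z) := by rw [er]; linear_combination -h6
  have key : ∀ t : ZMod m, ((2 : ZMod m) * z' = 2 * t) = (t.val % (3 * n) = z'.val % (3 * n)) := fun t ↦ by
    rw [two_mul_eq_iff₇ hm]
    exact propext eq_comm
  simp only [theta₇]
  rw [p4, p3, p2, p1]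
  simp only [key]
  ring

/-- **The distribution vectors of `ℤ/2·3ᵏ⁺¹` are killed by `Θ_z − Θ_{2z+4n} + Θ_{2z+n}`** (`z` a unit, `k ≥ 1`). [folklore] -/
private theorem theta₇_lambda_koD (hm : m = 6 * n) (hn : n = 3 ^ k) (hk : 1 ≤ k) {M : ℕ} (hM : M ∈ m.divisors)
    {z : ZMod m} (hz2 : ¬ 2 ∣ z.val) (hz3 : ¬ 3 ∣ z.val) (z' : ZMod m) :
    theta₇ n z (koD₇ m M z') - theta₇ n (2 * z + 4 * 𝔫) (koD₇ m M z') + theta₇ n (2 * z + 𝔫) (koD₇ m M z') = 0 := by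
  have hn0 : 0 < n := n_pos₇ hn
  have h3 := three_dvd_n₇ hn hk
  have hMdvd : M ∣ m := Nat.dvd_of_mem_divisors hM
  have hy1 : ¬ 3 ∣ ((2 : ZMod m) * z + 4 * 𝔫).val := by
    simpa using prime_three_add_mul_n₇ hm h3 (prime_three_two_mul₇ hm hz3) 4
  have hy2 : ¬ 3 ∣ ((2 : ZMod m) * z + 𝔫).val := by
    simpa using prime_three_add_mul_n₇ hm h3 (prime_three_two_mul₇ hm hz3) 1
  rcases dvd_cases₇ hm hn hMdvd with hM2 | hM3 | hMm
  · rw [theta₇_koD_of_dvd hm hn hk hM hM2 hz3, theta₇_koD_of_dvd hm hn hk hM hM2 hy1,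
      theta₇_koD_of_dvd hm hn hk hM hM2 hy2]
    ring
  · subst hM3
    have h3n : 3 * n ∣ m := ⟨2, by rw [hm]; ring⟩
    have hq : ((m / (3 * n) : ℕ) : ZMod m) = 2 := by
      rw [hm, show 6 * n = 2 * (3 * n) by ring, Nat.mul_div_cancel _ (by omega)]; norm_cast
    have split : ∀ y : ZMod m, theta₇ n y (koD₇ m (3 * n) z') =
        theta₇ n y (fun v ↦ if v.val % (3 * n) = z'.val % (3 * n) then (1 : ℚ) else 0) -
          theta₇ n y (fun v ↦ if (2 : ZMod m) * z' = v then (1 : ℚ) else 0) := by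
      intro y
      simp only [theta₇, koD₇, hq]
      ring
    -- the point `2z'` is even: invisible to `Θ_z` and `Θ_{2z+n}` (odd points)
    have hw : 2 ∣ ((2 : ZMod m) * z').val := two_dvd_val_two_mul₇ hm z'
    obtain ⟨a2, b2, c2⟩ := odd_points₇ hm hn0 hz2
    have hodd : ¬ 2 ∣ ((2 : ZMod m) * z + 𝔫).val := by simpa using odd_two_mul_add₇ hm hn z (j := 1) (by norm_num)
    obtain ⟨a2', b2', c2'⟩ := odd_points₇ hm hn0 hodd
    -- congruence parts of `Θ_{2z+4n}` and `Θ_{2z+n}` agree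
    have hcl : ((2 : ZMod m) * z + 4 * 𝔫).val % (3 * n) = ((2 : ZMod m) * z + 𝔫).val % (3 * n) := by
      rw [show (2 : ZMod m) * z + 4 * 𝔫 = (2 * z + 𝔫) + 𝔥 by rw [h_eq_three_mul₇.1]; ring]
      exact mod_add_of_dvd₇ h3n _ (by rw [val_h₇ hm hn0])
    rw [split, split, split, theta₇_point_dvd hw hz2 a2 b2 c2, theta₇_point_dvd hw hodd a2' b2' c2',
      theta₇_point_double hm z z', theta₇_congr_M h3n hcl z']
    ring
  · subst hMm
    have hz : koD₇ M M z' = fun _ ↦ 0 := funext (koD₇_self z')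
    rw [hz]
    simp [theta₇]

/-- **The bridge from Koblitz–Ogus to count identities** (as in part I). [cite: Deligne1982HodgeCycles, Rem. 7.16 (a)] -/
private theorem functional_count_eq_zero₇ {s : Multiset (ZMod m)} (hs : IsHodgeMultiset s) (L : (ZMod m → ℚ) → ℚ)
    (hadd : ∀ g g' : ZMod m → ℚ, L (fun z ↦ g z + g' z) = L g + L g')
    (hmul : ∀ (c : ℚ) (g : ZMod m → ℚ), L (fun z ↦ c * g z) = c * L g)
    (hsum : ∀ {ι : Type} (t : Finset ι) (g : ι → ZMod m → ℚ), L (fun z ↦ ∑ j ∈ t, g j z) = ∑ j ∈ t, L (g j))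
    (heven : ∀ g : ZMod m → ℚ, (∀ z, g (-z) = g z) → L g = 0)
    (hko : ∀ M ∈ m.divisors, ∀ y : ZMod m, L (koD₇ m M y) = 0) :
    L (fun w ↦ (count w s : ℚ)) = 0 := by
  classical
  obtain ⟨cr, cd, hrep⟩ := Literature.NumberTheory.Transcendental.KoblitzOgus.hodge_eq_combination
    (N := m) (fun x ↦ (count x s : ℚ)) (fun u hu ↦ hs.sum_count_mul_bern_eq_zero hu)
  have hf : (fun w ↦ (count w s : ℚ)) =
      fun w ↦ (∑ a : ZMod m, cr a * ((if a = w then (1 : ℚ) else 0) + (if -a = w then 1 else 0))) +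
        ∑ M ∈ m.divisors, ∑ y : ZMod m, cd M y * koD₇ m M y w := funext hrep
  rw [hf, hadd, hsum, hsum]
  have hA : ∀ a : ZMod m, L (fun w ↦ cr a * ((if a = w then (1 : ℚ) else 0) + (if -a = w then 1 else 0))) = 0 :=
    fun a ↦ by
      rw [hmul, heven _ fun w ↦ ?_, mul_zero]
      rw [add_comm]
      congr 1
      · simp only [neg_inj]
      · simp only [eq_neg_iff_add_eq_zero, neg_eq_iff_add_eq_zero]
  have hB : ∀ M ∈ m.divisors, L (fun w ↦ ∑ y : ZMod m, cd M y * koD₇ m M y w) = 0 := fun M hM ↦ by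
    rw [hsum]
    refine Finset.sum_eq_zero fun y _ ↦ ?_
    rw [hmul, hko M hM y, mul_zero]
  rw [Finset.sum_eq_zero fun a _ ↦ hA a, Finset.sum_eq_zero hB, add_zero]

omit [NeZero m] in
/-- From a rational identity between counts to the integer one. [folklore] -/
private theorem int_of_rat_eq₇ {a b : ℤ} (h : ((a : ℚ)) = b) : a = b := by exact_mod_cast h

/-- **Koblitz–Ogus at level `2·3ᵇ` (`b ≥ 2`), the `Λ`-relation.** For a Hodge multiset `s` over `ℤ/6n`, `n = 3ᵏ`, `k ≥ 1`, a
unit `z` (odd, prime to `3`), and `o(w) = #_w s − #_{−w} s`: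
**`o(z) + o(2z) − o(2z + 3n) = o(z + 2n) + o(2z + 4n) − o(2z + n)`**, i.e. `Λ(z) = Λ(z + 2n)` for
`Λ(z) = o(z) + o(2z) − o(2z + 3n)` (`2(z + 2n) = 2z + 4n`, `2(z + 2n) + 3n = 2z + n`). PROOF: the tree's PROVED
`KoblitzOgus.hodge_eq_combination` and `theta₇_lambda_koD`. This formalisation's lemma (the source proves the span statement);
it replaces part I's class relation, void at these levels. [cite: Deligne1982HodgeCycles, Rem. 7.16 (a)] [cite: Aoki1983, Prop. 2.2] -/
theorem countSub_lambda_twiceThreePow (hm : m = 6 * n) (hn : n = 3 ^ k) (hk : 1 ≤ k) {s : Multiset (ZMod m)}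
    (hs : IsHodgeMultiset s) {z : ZMod m} (hz2 : ¬ 2 ∣ z.val) (hz3 : ¬ 3 ∣ z.val) :
    𝔬[s, z] + 𝔬[s, 2 * z] - 𝔬[s, 2 * z + 3 * 𝔫] = 𝔬[s, z + 2 * 𝔫] + 𝔬[s, 2 * z + 4 * 𝔫] - 𝔬[s, 2 * z + 𝔫] := by
  have key := functional_count_eq_zero₇ hs
    (fun g ↦ theta₇ n z g - theta₇ n (2 * z + 4 * 𝔫) g + theta₇ n (2 * z + 𝔫) g)
    (fun g g' ↦ by rw [theta₇_add, theta₇_add, theta₇_add]; ring)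
    (fun c g ↦ by rw [theta₇_mul, theta₇_mul, theta₇_mul]; ring)
    (fun t g ↦ by rw [theta₇_sum, theta₇_sum, theta₇_sum, Finset.sum_add_distrib, Finset.sum_sub_distrib])
    (fun g hg ↦ by
      rw [theta₇_eq_zero_of_even z hg, theta₇_eq_zero_of_even _ hg, theta₇_eq_zero_of_even _ hg]; ring)
    (fun M hM z' ↦ theta₇_lambda_koD hm hn hk hM hz2 hz3 z')
  obtain ⟨-, er⟩ := h_eq_three_mul₇ (m := m) (n := n)
  have h6 := six_mul_n₇ hm
  have e1 : z + 𝔯 = z + 2 * 𝔫 := by rw [er]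
  have e2 : (2 : ZMod m) * z + 4 * 𝔫 + 𝔯 = 2 * z := by rw [er]; linear_combination h6
  have e3 : (2 : ZMod m) * z + 𝔫 + 𝔯 = 2 * z + 3 * 𝔫 := by rw [er]; ring
  simp only [theta₇] at key
  rw [e1, e2, e3] at key
  apply int_of_rat_eq₇
  push_cast at key ⊢
  linear_combination key


/-- **The two `Λ`-identities of a class, normal form.** For a unit `z` with `2z = w`: `Λ(z) = Λ(z + 2n) = Λ(z + 4n)`, written
with `2(z + 2n) = w + 4n`, `2(z + 2n) + 3n = w + n`, `2(z + 4n) = w + 2n`, `2(z + 4n) + 3n = w + 5n`.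
[cite: Deligne1982HodgeCycles, Rem. 7.16 (a)] [cite: Aoki1983, Prop. 2.2] -/
theorem lambda_class_twiceThreePow (hm : m = 6 * n) (hn : n = 3 ^ k) (hk : 1 ≤ k) {s : Multiset (ZMod m)}
    (hs : IsHodgeMultiset s) {z w : ZMod m} (hz2 : ¬ 2 ∣ z.val) (hz3 : ¬ 3 ∣ z.val) (hw : 2 * z = w) :
    (𝔬[s, z] + 𝔬[s, w] - 𝔬[s, w + 3 * 𝔫] = 𝔬[s, z + 2 * 𝔫] + 𝔬[s, w + 4 * 𝔫] - 𝔬[s, w + 𝔫]) ∧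
    (𝔬[s, z + 2 * 𝔫] + 𝔬[s, w + 4 * 𝔫] - 𝔬[s, w + 𝔫] =
      𝔬[s, z + 4 * 𝔫] + 𝔬[s, w + 2 * 𝔫] - 𝔬[s, w + 5 * 𝔫]) := by
  have hn0 : 0 < n := n_pos₇ hn
  have h3 := three_dvd_n₇ hn hk
  have h6 := six_mul_n₇ hm
  have E1 := countSub_lambda_twiceThreePow hm hn hk hs hz2 hz3
  rw [hw] at E1
  have hz2' : ¬ 2 ∣ (z + 2 * 𝔫).val := by
    have h2r : 2 ∣ ((2 : ZMod m) * 𝔫).val := by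
      rw [← h_eq_three_mul₇.2, val_r₇ hm hn0]; exact Dvd.intro n rfl
    rwa [dvd_val_add_iff₇ (two_dvd_m₇ hm) z h2r]
  have hz3' : ¬ 3 ∣ (z + 2 * 𝔫).val := by simpa using prime_three_add_mul_n₇ hm h3 hz3 2
  have E2 := countSub_lambda_twiceThreePow hm hn hk hs hz2' hz3'
  have e1 : z + 2 * 𝔫 + 2 * 𝔫 = z + 4 * 𝔫 := by ring
  have e2 : (2 : ZMod m) * (z + 2 * 𝔫) = w + 4 * 𝔫 := by rw [← hw]; ring
  have e3 : w + 4 * 𝔫 + 3 * 𝔫 = w + 𝔫 := by linear_combination h6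
  have e4 : w + 4 * 𝔫 + 4 * 𝔫 = w + 2 * 𝔫 := by linear_combination h6
  have e5 : w + 4 * 𝔫 + 𝔫 = w + 5 * 𝔫 := by ring
  rw [e1, e2, e3, e4, e5] at E2
  exact ⟨E1, E2⟩

/-! ### The hexagons `±a + nℤ` of `a = x₀, y, 2y, 4y` (`2x₀ = y + 3n`): `48` distinct points -/

omit [NeZero m] in
/-- `j·n` as a residue: `⟨j·n⟩ = j·n` for `j < 6`. [folklore] -/
private theorem val_natCast_mul_n₇ (hm : m = 6 * n) (hn0 : 0 < n) {j : ℕ} (hj : j < 6) :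
    (((j : ℕ) : ZMod m) * 𝔫).val = j * n := by
  rw [show ((j : ℕ) : ZMod m) * 𝔫 = ((j * n : ℕ) : ZMod m) by push_cast; ring, ZMod.val_natCast,
    Nat.mod_eq_of_lt (by rw [hm]; nlinarith)]

omit [NeZero m] in
/-- `j·n = l·n` with `j, l < 6` forces `j = l` (`n > 0`). [folklore] -/
private theorem natCast_mul_n_inj₇ (hm : m = 6 * n) (hn0 : 0 < n) {j l : ℕ} (hj : j < 6) (hl : l < 6)
    (h : ((j : ℕ) : ZMod m) * 𝔫 = ((l : ℕ) : ZMod m) * 𝔫) : j = l := by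
  have hv := congrArg ZMod.val h
  rw [val_natCast_mul_n₇ hm hn0 hj, val_natCast_mul_n₇ hm hn0 hl] at hv
  exact Nat.eq_of_mul_eq_mul_right hn0 hv

/-- **`2y + j·n ≠ 0`** for `y` prime to `3` (`3 ∣ n`): reduce modulo `3`. [folklore] -/
private theorem two_mul_add_ne_zero₇ (hm : m = 6 * n) (h3 : 3 ∣ n) {y : ZMod m} (hy3 : ¬ 3 ∣ y.val) (j : ℕ) :
    2 * y + ((j : ℕ) : ZMod m) * 𝔫 ≠ 0 := by
  intro h
  have h3m := three_dvd_m₇ hm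
  set ρ := ZMod.castHom h3m (ZMod 3) with hρ
  have hn3 : ρ (((j : ℕ) : ZMod m) * 𝔫) = 0 := (dvd_val_iff_cast₇ h3m _).mp (three_dvd_val_mul_n₇ hm h3 j)
  have hy' : ρ y ≠ 0 := fun e ↦ hy3 ((dvd_val_iff_cast₇ h3m y).mpr e)
  have e := congrArg ρ h
  rw [_root_.map_add, _root_.map_mul, hn3, add_zero, map_ofNat, _root_.map_zero] at e
  have key : ∀ x : ZMod 3, 2 * x = 0 → x = 0 := by decide
  exact hy' (key _ e)

variable (n) in
/-- The twelve points `±(a + j·n)`, `j = 0, …, 5`, indexed by `Fin 2 × Fin 6`. [folklore] -/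
private def pt₇ (a : ZMod m) (e : Fin 2 × Fin 6) : ZMod m :=
  if e.1 = 0 then a + ((e.2 : ℕ) : ZMod m) * 𝔫 else -(a + ((e.2 : ℕ) : ZMod m) * 𝔫)

/-- **The twelve points `±(a + j·n)` are pairwise distinct** (`a` prime to `3`, `3 ∣ n`). [folklore] -/
private theorem pt₇_injective (hm : m = 6 * n) (hn0 : 0 < n) (h3 : 3 ∣ n) {a : ZMod m} (ha3 : ¬ 3 ∣ a.val) :
    Function.Injective (pt₇ n a) := by
  rintro ⟨e, j⟩ ⟨e', l⟩ h
  have hj := j.isLt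
  have hl := l.isLt
  have same : a + ((j : ℕ) : ZMod m) * 𝔫 = a + ((l : ℕ) : ZMod m) * 𝔫 → j = l := fun e ↦
    Fin.ext (natCast_mul_n_inj₇ hm hn0 hj hl (add_left_cancel e))
  have opp : a + ((j : ℕ) : ZMod m) * 𝔫 ≠ -(a + ((l : ℕ) : ZMod m) * 𝔫) := by
    intro e2
    apply two_mul_add_ne_zero₇ hm h3 ha3 (j + l)
    push_cast
    linear_combination e2
  have opp' : -(a + ((j : ℕ) : ZMod m) * 𝔫) ≠ a + ((l : ℕ) : ZMod m) * 𝔫 := by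
    intro e2
    apply two_mul_add_ne_zero₇ hm h3 ha3 (l + j)
    push_cast
    linear_combination -e2
  fin_cases e <;> fin_cases e'
  · simp only [pt₇, Fin.zero_eta, Fin.isValue, ↓reduceIte] at h
    rw [same h]
  · simp only [pt₇, Fin.zero_eta, Fin.isValue, ↓reduceIte, Fin.mk_one, one_ne_zero] at h
    exact absurd h opp
  · simp only [pt₇, Fin.mk_one, Fin.isValue, one_ne_zero, ↓reduceIte, Fin.zero_eta] at h
    exact absurd h opp'
  · simp only [pt₇, Fin.mk_one, Fin.isValue, one_ne_zero, ↓reduceIte, neg_inj] at h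
    rw [same h]

omit [NeZero m] in
/-- The reduction modulo `n` kills `n`. [folklore] -/
private theorem castHom_n₇ (hnm : n ∣ m) : ZMod.castHom hnm (ZMod n) 𝔫 = 0 := by
  rw [map_natCast, ZMod.natCast_self]

omit [NeZero m] in
/-- **Disjoint hexagons.** If `b ≢ ±a (mod n)` then no point `±(a + j·n)` equals a point `±(b + l·n)`. [folklore] -/
private theorem ne_of_hexagons₇ (hnm : n ∣ m) {a b : ZMod m}
    (h₁ : ZMod.castHom hnm (ZMod n) b ≠ ZMod.castHom hnm (ZMod n) a)
    (h₂ : ZMod.castHom hnm (ZMod n) b ≠ -ZMod.castHom hnm (ZMod n) a) (e e' : Fin 2 × Fin 6) :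
    pt₇ n a e ≠ pt₇ n b e' := by
  set π := ZMod.castHom hnm (ZMod n) with hπ
  have hπn : π 𝔫 = 0 := castHom_n₇ hnm
  have ea : ∀ t : ℕ, π (a + ((t : ℕ) : ZMod m) * 𝔫) = π a := fun t ↦ by
    rw [_root_.map_add, _root_.map_mul, hπn, mul_zero, add_zero]
  have eb : ∀ t : ℕ, π (b + ((t : ℕ) : ZMod m) * 𝔫) = π b := fun t ↦ by
    rw [_root_.map_add, _root_.map_mul, hπn, mul_zero, add_zero]
  obtain ⟨i, j⟩ := e
  obtain ⟨i', l⟩ := e'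
  intro h
  fin_cases i <;> fin_cases i' <;>
    simp only [pt₇, Fin.zero_eta, Fin.isValue, ↓reduceIte, Fin.mk_one, one_ne_zero] at h <;>
    have e := congrArg π h
  · rw [ea, eb] at e; exact h₁ e.symm
  · rw [ea, _root_.map_neg, eb] at e; exact h₂ (by linear_combination e)
  · rw [_root_.map_neg, ea, eb] at e; exact h₂ (by linear_combination -e)
  · rw [_root_.map_neg, _root_.map_neg, ea, eb, neg_inj] at e; exact h₁ e.symm

/-- A small multiple of a unit of `ℤ/3ᵏ` (`k ≥ 3`) is non-zero: `c·X ≠ 0` for `0 < c < 27`. [folklore] -/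
private theorem smallMul_ne_zero₇ (hn : n = 3 ^ k) (hk : 3 ≤ k) [NeZero n] {X : ZMod n} (hX : IsUnit X) {c : ℕ}
    (hc0 : 0 < c) (hc : c < 27) : (c : ZMod n) * X ≠ 0 := by
  have h27 : 27 ≤ n := by
    rw [hn]
    calc (27 : ℕ) = 3 ^ 3 := by norm_num
      _ ≤ 3 ^ k := Nat.pow_le_pow_right (by norm_num) hk
  rw [Ne, hX.mul_left_eq_zero, ZMod.natCast_eq_zero_iff]
  intro h
  have := Nat.le_of_dvd hc0 h
  omega

variable (n) in
/-- The `48` points of the four hexagons of `x₀, y, 2y, 4y`. [folklore] -/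
private def pt4₇ (x₀ y : ZMod m) (e : Fin 4 × (Fin 2 × Fin 6)) : ZMod m :=
  pt₇ n (if e.1 = 0 then x₀ else if e.1 = 1 then y else if e.1 = 2 then 2 * y else 4 * y) e.2

/-- **The `48` points are pairwise distinct** (`y` prime to `3`, `2x₀ = y + 3n`, `27 ∣ n`): within a hexagon by `pt₇_injective`;
across, the reductions modulo `n` of the four base points are `X, 2X, 4X, 8X` for the unit `X = x₀ mod n`. [folklore] -/
private theorem pt4₇_injective (hm : m = 6 * n) (hn : n = 3 ^ k) (hk : 3 ≤ k) {x₀ y : ZMod m} (hy3 : ¬ 3 ∣ y.val)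
    (hx : 2 * x₀ = y + 3 * 𝔫) : Function.Injective (pt4₇ n x₀ y) := by
  have hn0 : 0 < n := n_pos₇ hn
  haveI : NeZero n := ⟨hn0.ne'⟩
  have h3 := three_dvd_n₇ hn (by omega)
  have hnm : n ∣ m := ⟨6, by rw [hm]; ring⟩
  have hx3 : ¬ 3 ∣ x₀.val := prime_three_half₇ hm h3 hy3 hx
  have hy2' : ¬ 3 ∣ ((2 : ZMod m) * y).val := prime_three_two_mul₇ hm hy3
  have hy4' : ¬ 3 ∣ ((4 : ZMod m) * y).val := by
    have := prime_three_two_mul₇ hm hy2'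
    rwa [show (2 : ZMod m) * (2 * y) = 4 * y by ring] at this
  -- reductions modulo `n`: the base points reduce to `X, 2X, 4X, 8X`, `X = x₀ mod n` a unit
  set π := ZMod.castHom hnm (ZMod n) with hπ
  have hπn : π 𝔫 = 0 := castHom_n₇ hnm
  have hXu : IsUnit (π x₀) := by
    rw [hπ, ZMod.castHom_apply, ZMod.cast_eq_val, ZMod.isUnit_iff_coprime, hn]
    exact (Nat.Coprime.pow_right k ((Nat.Prime.coprime_iff_not_dvd Nat.prime_three).mpr hx3).symm)
  have πy : π y = 2 * π x₀ := by
    have e := congrArg π hx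
    rw [_root_.map_mul, map_ofNat, _root_.map_add, _root_.map_mul, hπn, mul_zero, add_zero] at e
    rw [← e]
  have π2y : π (2 * y) = 4 * π x₀ := by rw [_root_.map_mul, map_ofNat, πy]; ring
  have π4y : π (4 * y) = 8 * π x₀ := by rw [_root_.map_mul, map_ofNat, πy]; ring
  have NZ : ∀ c : ℕ, 0 < c → c < 27 → (c : ZMod n) * π x₀ ≠ 0 := fun c hc0 hc ↦ smallMul_ne_zero₇ hn hk hXu hc0 hc
  have hb3 : ∀ b : Fin 4, ¬ 3 ∣ (if b = 0 then x₀ else if b = 1 then y else if b = 2 then 2 * y else 4 * y).val := by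
    intro b
    fin_cases b
    · simpa using hx3
    · simpa using hy3
    · simpa using hy2'
    · simpa using hy4'
  -- the twelve ordered pairs of distinct hexagons
  have D2 : ∀ b b' : Fin 4, b ≠ b' →
      π (if b' = 0 then x₀ else if b' = 1 then y else if b' = 2 then 2 * y else 4 * y) ≠
          π (if b = 0 then x₀ else if b = 1 then y else if b = 2 then 2 * y else 4 * y) ∧
        π (if b' = 0 then x₀ else if b' = 1 then y else if b' = 2 then 2 * y else 4 * y) ≠
          -π (if b = 0 then x₀ else if b = 1 then y else if b = 2 then 2 * y else 4 * y) := by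
    intro b b' hbb
    fin_cases b <;> fin_cases b' <;>
      simp only [Fin.zero_eta, Fin.mk_one, Fin.isValue, Fin.reduceFinMk, Fin.reduceEq, ↓reduceIte, ne_eq,
        not_true_eq_false, not_false_eq_true, one_ne_zero, πy, π2y, π4y] at hbb ⊢
    · exact ⟨fun h ↦ NZ 1 (by norm_num) (by norm_num) (by linear_combination h),
        fun h ↦ NZ 3 (by norm_num) (by norm_num) (by linear_combination h)⟩
    · exact ⟨fun h ↦ NZ 3 (by norm_num) (by norm_num) (by linear_combination h),
        fun h ↦ NZ 5 (by norm_num) (by norm_num) (by linear_combination h)⟩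
    · exact ⟨fun h ↦ NZ 7 (by norm_num) (by norm_num) (by linear_combination h),
        fun h ↦ NZ 9 (by norm_num) (by norm_num) (by linear_combination h)⟩
    · exact ⟨fun h ↦ NZ 1 (by norm_num) (by norm_num) (by linear_combination -h),
        fun h ↦ NZ 3 (by norm_num) (by norm_num) (by linear_combination h)⟩
    · exact ⟨fun h ↦ NZ 2 (by norm_num) (by norm_num) (by linear_combination h),
        fun h ↦ NZ 6 (by norm_num) (by norm_num) (by linear_combination h)⟩
    · exact ⟨fun h ↦ NZ 6 (by norm_num) (by norm_num) (by linear_combination h),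
        fun h ↦ NZ 10 (by norm_num) (by norm_num) (by linear_combination h)⟩
    · exact ⟨fun h ↦ NZ 3 (by norm_num) (by norm_num) (by linear_combination -h),
        fun h ↦ NZ 5 (by norm_num) (by norm_num) (by linear_combination h)⟩
    · exact ⟨fun h ↦ NZ 2 (by norm_num) (by norm_num) (by linear_combination -h),
        fun h ↦ NZ 6 (by norm_num) (by norm_num) (by linear_combination h)⟩
    · exact ⟨fun h ↦ NZ 4 (by norm_num) (by norm_num) (by linear_combination h),
        fun h ↦ NZ 12 (by norm_num) (by norm_num) (by linear_combination h)⟩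
    · exact ⟨fun h ↦ NZ 7 (by norm_num) (by norm_num) (by linear_combination -h),
        fun h ↦ NZ 9 (by norm_num) (by norm_num) (by linear_combination h)⟩
    · exact ⟨fun h ↦ NZ 6 (by norm_num) (by norm_num) (by linear_combination -h),
        fun h ↦ NZ 10 (by norm_num) (by norm_num) (by linear_combination h)⟩
    · exact ⟨fun h ↦ NZ 4 (by norm_num) (by norm_num) (by linear_combination -h),
        fun h ↦ NZ 12 (by norm_num) (by norm_num) (by linear_combination h)⟩
  rintro ⟨b, e⟩ ⟨b', e'⟩ h
  simp only [pt4₇] at h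
  by_cases hbb : b = b'
  · subst hbb
    exact Prod.ext rfl (pt₇_injective hm hn0 h3 (hb3 b) h)
  · exfalso
    obtain ⟨d1, d2⟩ := D2 b b' hbb
    exact ne_of_hexagons₇ hnm d1 d2 e e' h

/-! ### The abstract token calculus (`decide +kernel`) -/

/-- Abstract multiplicity at the point of index `j` of the token configuration `(12 = y, i₁, i₂, i₃)` (indices `< 48` are the
`48` points `x₀ + ln, −(x₀ + ln), y + ln, −(y + ln), 2y + ln, −(2y + ln), 4y + ln, −(4y + ln)` (`l < 6`) in this order,
`48` = elsewhere). [folklore] -/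
private def cA (i₁ i₂ i₃ j : ℕ) : ℕ :=
  (if j = 12 then 1 else 0) + (if i₁ = j then 1 else 0) + (if i₂ = j then 1 else 0) + (if i₃ = j then 1 else 0)

/-- The six `Λ`-identities (classes of `y`, `x₀`, `2y + 3n`) and `#_{−y} = 0`, abstractly. [folklore] -/
private def hypA (i₁ i₂ i₃ : ℕ) : Prop :=
  (cA i₁ i₂ i₃ 12 + cA i₁ i₂ i₃ 20 + cA i₁ i₂ i₃ 24 + cA i₁ i₂ i₃ 25 + cA i₁ i₂ i₃ 33 + cA i₁ i₂ i₃ 34 = cA i₁ i₂ i₃ 14 + cA i₁ i₂ i₃ 18 + cA i₁ i₂ i₃ 27 + cA i₁ i₂ i₃ 28 + cA i₁ i₂ i₃ 30 + cA i₁ i₂ i₃ 31) ∧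
    (cA i₁ i₂ i₃ 14 + cA i₁ i₂ i₃ 22 + cA i₁ i₂ i₃ 28 + cA i₁ i₂ i₃ 29 + cA i₁ i₂ i₃ 31 + cA i₁ i₂ i₃ 32 = cA i₁ i₂ i₃ 16 + cA i₁ i₂ i₃ 20 + cA i₁ i₂ i₃ 25 + cA i₁ i₂ i₃ 26 + cA i₁ i₂ i₃ 34 + cA i₁ i₂ i₃ 35) ∧
    (cA i₁ i₂ i₃ 0 + cA i₁ i₂ i₃ 8 + cA i₁ i₂ i₃ 15 + cA i₁ i₂ i₃ 16 + cA i₁ i₂ i₃ 18 + cA i₁ i₂ i₃ 19 = cA i₁ i₂ i₃ 2 + cA i₁ i₂ i₃ 6 + cA i₁ i₂ i₃ 12 + cA i₁ i₂ i₃ 13 + cA i₁ i₂ i₃ 21 + cA i₁ i₂ i₃ 22) ∧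
    (cA i₁ i₂ i₃ 2 + cA i₁ i₂ i₃ 10 + cA i₁ i₂ i₃ 13 + cA i₁ i₂ i₃ 14 + cA i₁ i₂ i₃ 22 + cA i₁ i₂ i₃ 23 = cA i₁ i₂ i₃ 4 + cA i₁ i₂ i₃ 8 + cA i₁ i₂ i₃ 16 + cA i₁ i₂ i₃ 17 + cA i₁ i₂ i₃ 19 + cA i₁ i₂ i₃ 20) ∧
    (cA i₁ i₂ i₃ 27 + cA i₁ i₂ i₃ 35 + cA i₁ i₂ i₃ 36 + cA i₁ i₂ i₃ 37 + cA i₁ i₂ i₃ 45 + cA i₁ i₂ i₃ 46 = cA i₁ i₂ i₃ 29 + cA i₁ i₂ i₃ 33 + cA i₁ i₂ i₃ 39 + cA i₁ i₂ i₃ 40 + cA i₁ i₂ i₃ 42 + cA i₁ i₂ i₃ 43) ∧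
    (cA i₁ i₂ i₃ 29 + cA i₁ i₂ i₃ 31 + cA i₁ i₂ i₃ 40 + cA i₁ i₂ i₃ 41 + cA i₁ i₂ i₃ 43 + cA i₁ i₂ i₃ 44 = cA i₁ i₂ i₃ 25 + cA i₁ i₂ i₃ 35 + cA i₁ i₂ i₃ 37 + cA i₁ i₂ i₃ 38 + cA i₁ i₂ i₃ 46 + cA i₁ i₂ i₃ 47) ∧
    cA i₁ i₂ i₃ 18 = 0

/-- The seventeen cores, abstractly. [folklore] -/
private def coreA (i₁ i₂ i₃ : ℕ) : Prop :=
  (1 ≤ cA i₁ i₂ i₃ 14 ∧ 1 ≤ cA i₁ i₂ i₃ 16) ∨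
    (1 ≤ cA i₁ i₂ i₃ 15 ∧ 1 ≤ cA i₁ i₂ i₃ 30) ∨
    (1 ≤ cA i₁ i₂ i₃ 15 ∧ 1 ≤ cA i₁ i₂ i₃ 27 ∧ 1 ≤ cA i₁ i₂ i₃ 42) ∨
    (cA i₁ i₂ i₃ 0 = 1 ∧ 1 ≤ cA i₁ i₂ i₃ 30) ∨
    (1 ≤ cA i₁ i₂ i₃ 0 ∧ 1 ≤ cA i₁ i₂ i₃ 26 ∧ 1 ≤ cA i₁ i₂ i₃ 28) ∨
    (1 ≤ cA i₁ i₂ i₃ 0 ∧ 1 ≤ cA i₁ i₂ i₃ 27 ∧ 1 ≤ cA i₁ i₂ i₃ 42) ∨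
    (1 ≤ cA i₁ i₂ i₃ 0 ∧ 1 ≤ cA i₁ i₂ i₃ 27 ∧ 1 ≤ cA i₁ i₂ i₃ 39) ∨
    (1 ≤ cA i₁ i₂ i₃ 8 ∧ 1 ≤ cA i₁ i₂ i₃ 10 ∧ 1 ≤ cA i₁ i₂ i₃ 30) ∨
    (1 ≤ cA i₁ i₂ i₃ 8 ∧ 1 ≤ cA i₁ i₂ i₃ 14 ∧ 1 ≤ cA i₁ i₂ i₃ 26) ∨
    (1 ≤ cA i₁ i₂ i₃ 8 ∧ 1 ≤ cA i₁ i₂ i₃ 23 ∧ 1 ≤ cA i₁ i₂ i₃ 30) ∨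
    (1 ≤ cA i₁ i₂ i₃ 10 ∧ 1 ≤ cA i₁ i₂ i₃ 19 ∧ 1 ≤ cA i₁ i₂ i₃ 30) ∨
    (1 ≤ cA i₁ i₂ i₃ 10 ∧ 1 ≤ cA i₁ i₂ i₃ 16 ∧ 1 ≤ cA i₁ i₂ i₃ 28) ∨
    (1 ≤ cA i₁ i₂ i₃ 19 ∧ 1 ≤ cA i₁ i₂ i₃ 14 ∧ 1 ≤ cA i₁ i₂ i₃ 26) ∨
    (1 ≤ cA i₁ i₂ i₃ 19 ∧ 1 ≤ cA i₁ i₂ i₃ 23 ∧ 1 ≤ cA i₁ i₂ i₃ 30) ∨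
    (1 ≤ cA i₁ i₂ i₃ 15 ∧ 1 ≤ cA i₁ i₂ i₃ 26 ∧ 1 ≤ cA i₁ i₂ i₃ 28) ∨
    (1 ≤ cA i₁ i₂ i₃ 15 ∧ 1 ≤ cA i₁ i₂ i₃ 27 ∧ 1 ≤ cA i₁ i₂ i₃ 39) ∨
    (1 ≤ cA i₁ i₂ i₃ 16 ∧ 1 ≤ cA i₁ i₂ i₃ 23 ∧ 1 ≤ cA i₁ i₂ i₃ 28)

/-- `hypA` is decidable. [folklore] -/
private instance (i₁ i₂ i₃ : ℕ) : Decidable (hypA i₁ i₂ i₃) := by unfold hypA; infer_instance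

/-- `coreA` is decidable. [folklore] -/
private instance (i₁ i₂ i₃ : ℕ) : Decidable (coreA i₁ i₂ i₃) := by unfold coreA; infer_instance

/-- One sorted configuration: `i₁ ≤ i₂ ≤ i₃` and the six identities force a core. [folklore] -/
private def stmtA (i₁ i₂ i₃ : ℕ) : Prop :=
  i₁ ≤ i₂ → i₂ ≤ i₃ → hypA i₁ i₂ i₃ → coreA i₁ i₂ i₃

/-- `stmtA` is decidable. [folklore] -/
private instance (i₁ i₂ i₃ : ℕ) : Decidable (stmtA i₁ i₂ i₃) := by unfold stmtA; infer_instance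

set_option maxHeartbeats 4000000 in
/-- **The abstract decision** (sorted configurations): every token configuration `i₁ ≤ i₂ ≤ i₃` satisfying the six
identities has one of the seventeen cores (`20825` sorted configurations among `49³`, checked by the kernel). [folklore] -/
private theorem stmtA_all : ∀ i₁ < 49, ∀ i₂ < 49, ∀ i₃ < 49, stmtA i₁ i₂ i₃ := by
  decide +kernel

/-- `cA` is symmetric in the three tokens. [folklore] -/
private theorem cA_swap₁₂ (i₁ i₂ i₃ : ℕ) : cA i₁ i₂ i₃ = cA i₂ i₁ i₃ := by
  funext j; unfold cA; split_ifs <;> rfl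

/-- `cA` is symmetric in the three tokens. [folklore] -/
private theorem cA_swap₂₃ (i₁ i₂ i₃ : ℕ) : cA i₁ i₂ i₃ = cA i₁ i₃ i₂ := by
  funext j; unfold cA; split_ifs <;> rfl

/-- `hypA` is symmetric in the tokens. [folklore] -/
private theorem hypA_swap₁₂ (i₁ i₂ i₃ : ℕ) : hypA i₁ i₂ i₃ ↔ hypA i₂ i₁ i₃ := by
  unfold hypA; rw [cA_swap₁₂]

/-- `hypA` is symmetric in the tokens. [folklore] -/
private theorem hypA_swap₂₃ (i₁ i₂ i₃ : ℕ) : hypA i₁ i₂ i₃ ↔ hypA i₁ i₃ i₂ := by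
  unfold hypA; rw [cA_swap₂₃]

/-- `coreA` is symmetric in the tokens. [folklore] -/
private theorem coreA_swap₁₂ (i₁ i₂ i₃ : ℕ) : coreA i₁ i₂ i₃ ↔ coreA i₂ i₁ i₃ := by
  unfold coreA; rw [cA_swap₁₂]

/-- `coreA` is symmetric in the tokens. [folklore] -/
private theorem coreA_swap₂₃ (i₁ i₂ i₃ : ℕ) : coreA i₁ i₂ i₃ ↔ coreA i₁ i₃ i₂ := by
  unfold coreA; rw [cA_swap₂₃]

/-- **The abstract decision**: every token configuration satisfying the six identities has one of the seventeen cores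
(sort the tokens). [folklore] -/
private theorem coreA_of_hypA {i₁ i₂ i₃ : ℕ} (h₁ : i₁ < 49) (h₂ : i₂ < 49) (h₃ : i₃ < 49) (h : hypA i₁ i₂ i₃) :
    coreA i₁ i₂ i₃ := by
  have S : ∀ {a b c : ℕ}, a < 49 → b < 49 → c < 49 → a ≤ b → b ≤ c → hypA a b c → coreA a b c :=
    fun ha hb hc ↦ stmtA_all _ ha _ hb _ hc
  rcases le_total i₁ i₂ with a | a <;> rcases le_total i₂ i₃ with b | b <;> rcases le_total i₁ i₃ with c | c
  · exact S h₁ h₂ h₃ a b h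
  · exact S h₁ h₂ h₃ a b h
  · -- `i₁ ≤ i₃ ≤ i₂`
    exact (coreA_swap₂₃ _ _ _).mpr (S h₁ h₃ h₂ c b ((hypA_swap₂₃ _ _ _).mp h))
  · -- `i₃ ≤ i₁ ≤ i₂`
    exact (hypA_swap₂₃ _ _ _).mp h |> (hypA_swap₁₂ _ _ _).mp |> S h₃ h₁ h₂ c a |>
      (coreA_swap₁₂ _ _ _).mpr |> (coreA_swap₂₃ _ _ _).mpr
  · -- `i₂ ≤ i₁ ≤ i₃`
    exact (coreA_swap₁₂ _ _ _).mpr (S h₂ h₁ h₃ a c ((hypA_swap₁₂ _ _ _).mp h))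
  · -- `i₂ ≤ i₃ ≤ i₁`
    exact (hypA_swap₁₂ _ _ _).mp h |> (hypA_swap₂₃ _ _ _).mp |> S h₂ h₃ h₁ b c |>
      (coreA_swap₂₃ _ _ _).mpr |> (coreA_swap₁₂ _ _ _).mpr
  · -- `i₂ ≤ i₁ ≤ i₃` again (`i₃ ≤ i₂ ≤ i₁ ≤ i₃`)
    exact (coreA_swap₁₂ _ _ _).mpr (S h₂ h₁ h₃ a c ((hypA_swap₁₂ _ _ _).mp h))
  · -- `i₃ ≤ i₂ ≤ i₁`
    exact (hypA_swap₂₃ _ _ _).mp h |> (hypA_swap₁₂ _ _ _).mp |> (hypA_swap₂₃ _ _ _).mp |> S h₃ h₂ h₁ b a |>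
      (coreA_swap₂₃ _ _ _).mpr |> (coreA_swap₁₂ _ _ _).mpr |> (coreA_swap₂₃ _ _ _).mpr

/-! ### The bridge: the `48` points as indices, token types, abstract counts -/

/-- Decoding an index `j < 48` into (hexagon, sign, multiple of `n`). [folklore] -/
private def dec (j : ℕ) : Fin 4 × (Fin 2 × Fin 6) :=
  (⟨j / 12 % 4, Nat.mod_lt _ (by norm_num)⟩, ⟨j / 6 % 2, Nat.mod_lt _ (by norm_num)⟩, ⟨j % 6, Nat.mod_lt _ (by norm_num)⟩)

omit [NeZero m] in
/-- `dec` is injective on `[0, 48)`. [folklore] -/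
private theorem dec_inj {j j' : ℕ} (hj : j < 48) (hj' : j' < 48) (h : dec j = dec j') : j = j' := by
  simp only [dec, Prod.mk.injEq, Fin.mk.injEq] at h
  omega

variable (n) in
/-- The point of index `j`: `x₀ + ln, −(x₀ + ln), y + ln, −(y + ln), 2y + ln, −(2y + ln), 4y + ln, −(4y + ln)` for
`j = l, 6 + l, 12 + l, …, 42 + l` (`l < 6`). [folklore] -/
private def P48 (x₀ y : ZMod m) (j : ℕ) : ZMod m :=
  pt4₇ n x₀ y (dec j)

omit [NeZero m] in
/-- `P48` is injective on `[0, 48)` (under the hypotheses of `pt4₇_injective`). [folklore] -/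
private theorem P48_inj {x₀ y : ZMod m} (hinj : Function.Injective (pt4₇ n x₀ y)) {j j' : ℕ} (hj : j < 48)
    (hj' : j' < 48) (h : P48 n x₀ y j = P48 n x₀ y j') : j = j' :=
  dec_inj hj hj' (hinj h)

omit [NeZero m] in
/-- The values of `P48` at the indices used below. [folklore] -/
private theorem P48_vals (x₀ y : ZMod m) :
    P48 n x₀ y 0 = x₀ ∧
    P48 n x₀ y 2 = x₀ + 2 * 𝔫 ∧
    P48 n x₀ y 4 = x₀ + 4 * 𝔫 ∧
    P48 n x₀ y 6 = -x₀ ∧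
    P48 n x₀ y 8 = -(x₀ + 2 * 𝔫) ∧
    P48 n x₀ y 10 = -(x₀ + 4 * 𝔫) ∧
    P48 n x₀ y 12 = y ∧
    P48 n x₀ y 13 = y + 𝔫 ∧
    P48 n x₀ y 14 = y + 2 * 𝔫 ∧
    P48 n x₀ y 15 = y + 3 * 𝔫 ∧
    P48 n x₀ y 16 = y + 4 * 𝔫 ∧
    P48 n x₀ y 17 = y + 5 * 𝔫 ∧
    P48 n x₀ y 18 = -y ∧
    P48 n x₀ y 19 = -(y + 𝔫) ∧
    P48 n x₀ y 20 = -(y + 2 * 𝔫) ∧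
    P48 n x₀ y 21 = -(y + 3 * 𝔫) ∧
    P48 n x₀ y 22 = -(y + 4 * 𝔫) ∧
    P48 n x₀ y 23 = -(y + 5 * 𝔫) ∧
    P48 n x₀ y 24 = 2 * y ∧
    P48 n x₀ y 25 = 2 * y + 𝔫 ∧
    P48 n x₀ y 26 = 2 * y + 2 * 𝔫 ∧
    P48 n x₀ y 27 = 2 * y + 3 * 𝔫 ∧
    P48 n x₀ y 28 = 2 * y + 4 * 𝔫 ∧
    P48 n x₀ y 29 = 2 * y + 5 * 𝔫 ∧
    P48 n x₀ y 30 = -(2 * y) ∧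
    P48 n x₀ y 31 = -(2 * y + 𝔫) ∧
    P48 n x₀ y 32 = -(2 * y + 2 * 𝔫) ∧
    P48 n x₀ y 33 = -(2 * y + 3 * 𝔫) ∧
    P48 n x₀ y 34 = -(2 * y + 4 * 𝔫) ∧
    P48 n x₀ y 35 = -(2 * y + 5 * 𝔫) ∧
    P48 n x₀ y 36 = 4 * y ∧
    P48 n x₀ y 37 = 4 * y + 𝔫 ∧
    P48 n x₀ y 38 = 4 * y + 2 * 𝔫 ∧
    P48 n x₀ y 39 = 4 * y + 3 * 𝔫 ∧
    P48 n x₀ y 40 = 4 * y + 4 * 𝔫 ∧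
    P48 n x₀ y 41 = 4 * y + 5 * 𝔫 ∧
    P48 n x₀ y 42 = -(4 * y) ∧
    P48 n x₀ y 43 = -(4 * y + 𝔫) ∧
    P48 n x₀ y 44 = -(4 * y + 2 * 𝔫) ∧
    P48 n x₀ y 45 = -(4 * y + 3 * 𝔫) ∧
    P48 n x₀ y 46 = -(4 * y + 4 * 𝔫) ∧
    P48 n x₀ y 47 = -(4 * y + 5 * 𝔫) := by
  have e3 : ((3 : Fin 6) : ℕ) = 3 := rfl
  have e4 : ((4 : Fin 6) : ℕ) = 4 := rfl
  have e5 : ((5 : Fin 6) : ℕ) = 5 := rfl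
  simp only [P48, dec, pt4₇, pt₇, Nat.reduceDiv, Nat.reduceMod, Fin.isValue, Fin.reduceEq, Fin.reduceFinMk, ↓reduceIte,
    Fin.val_zero, Nat.cast_zero, zero_mul, add_zero, Fin.val_one, Nat.cast_one, one_mul, Fin.val_two, Nat.cast_ofNat,
    e3, e4, e5, and_self]

omit [NeZero m] in
/-- Existence for `ty`. [folklore] -/
private theorem ty_aux (x₀ y v : ZMod m) : ∃ j : ℕ, (j < 48 ∧ P48 n x₀ y j = v) ∨ j = 48 := ⟨48, Or.inr rfl⟩

variable (n) in
/-- The TYPE of a residue `v`: the index `j < 48` with `P48 j = v` if there is one, else `48`. [folklore] -/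
private noncomputable def ty (x₀ y v : ZMod m) : ℕ := by
  classical exact Nat.find (ty_aux (n := n) x₀ y v)

omit [NeZero m] in
/-- `ty v ≤ 48`. [folklore] -/
private theorem ty_le (x₀ y v : ZMod m) : ty n x₀ y v ≤ 48 := by
  classical
  unfold ty
  exact Nat.find_min' _ (Or.inr rfl)

omit [NeZero m] in
/-- **`P48 j = v ⟺ ty v = j`** for `j < 48` (injectivity). [folklore] -/
private theorem P48_eq_iff {x₀ y : ZMod m} (hinj : Function.Injective (pt4₇ n x₀ y)) {j : ℕ} (hj : j < 48) (v : ZMod m) :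
    P48 n x₀ y j = v ↔ ty n x₀ y v = j := by
  classical
  have hspec : (ty n x₀ y v < 48 ∧ P48 n x₀ y (ty n x₀ y v) = v) ∨ ty n x₀ y v = 48 := by
    unfold ty
    exact Nat.find_spec (ty_aux (n := n) x₀ y v)
  constructor
  · intro h
    have h1 : ty n x₀ y v ≤ j := by
      unfold ty
      exact Nat.find_min' _ (Or.inl ⟨hj, h⟩)
    rcases hspec with ⟨hlt, hP⟩ | h48
    · exact P48_inj hinj hlt hj (hP.trans h.symm)
    · omega
  · rintro rfl
    rcases hspec with ⟨-, hP⟩ | h48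
    · exact hP
    · omega

omit [NeZero m] in
/-- **The multiplicities of `s = {y, t₁, t₂, t₃}` at the `48` points are the abstract counts of the token types.** [folklore] -/
private theorem count_P48 {x₀ y : ZMod m} (hinj : Function.Injective (pt4₇ n x₀ y)) (hy : P48 n x₀ y 12 = y)
    (t₁ t₂ t₃ : ZMod m) {j : ℕ} (hj : j < 48) :
    count (P48 n x₀ y j) (y ::ₘ {t₁, t₂, t₃}) = cA (ty n x₀ y t₁) (ty n x₀ y t₂) (ty n x₀ y t₃) j := by
  have e0 : (P48 n x₀ y j = y) ↔ (j = 12) := by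
    constructor
    · intro h
      exact P48_inj hinj hj (by norm_num) (h.trans hy.symm)
    · rintro rfl
      exact hy
  have e1 := P48_eq_iff hinj hj t₁
  have e2 := P48_eq_iff hinj hj t₂
  have e3 := P48_eq_iff hinj hj t₃
  simp only [Multiset.insert_eq_cons, Multiset.count_cons, Multiset.count_singleton, cA, e0, e1, e2, e3]
  split_ifs <;> omega

omit [NeZero m] in
/-- In a pair-free multiset, a member `w ≠ −w` excludes `−w`. [cite: Shioda1982PicardFermat, §2 p. 726] -/
private theorem count_neg_eq_zero_of_not_hasPair₇ {s : Multiset (ZMod m)} (hpf : ¬ HasPair s) {w : ZMod m} (hw : w ≠ -w)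
    (hws : w ∈ s) : count (-w) s = 0 := by
  by_contra h
  apply hpf
  refine ⟨w, hws, ?_⟩
  rw [← Multiset.count_pos, Multiset.count_erase_of_ne hw.symm]
  exact Nat.pos_of_ne_zero h

/-- `w ≠ −w` for `w` prime to `3` (`2w ≠ 0` modulo `3`). [folklore] -/
private theorem ne_neg_of_prime_three₇ (hm : m = 6 * n) (h3 : 3 ∣ n) {w : ZMod m} (hw3 : ¬ 3 ∣ w.val) : w ≠ -w := by
  intro e
  apply two_mul_add_ne_zero₇ hm h3 hw3 0
  push_cast
  linear_combination e

/-- **The decision.** `m = 6n`, `n = 3ᵏ`, `k ≥ 3`; `s` a pair-free Hodge `4`-multiset, `y ∈ s` a unit, `2x₀ = y + 3n` with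
`x₀` odd. The six `Λ`-identities of the classes of `x₀`, `y`, `2y + 3n` (whose `48` points are pairwise distinct) and
`#_{−y} = 0` leave exactly seventeen configurations ("cores"; the first four are `γ_y`, `α_y`, `β_y`, `β_{x₀}` up to the
member fixed by the zero sum, the other thirteen contradict the zero sum, see `shape_of_unit_twiceThreePow`). PROOF: the
three further members of `s` have TYPES (one of the `48` points, or "elsewhere"); the identities and the conclusion depend
on the types only (`count_P48`), and the `49³` type configurations are decided by the kernel (`coreA_of_hypA`).
[cite: Aoki1983, Thm. C] [cite: AokiShioda1983, §2 Thm. (𝔅²ₘ) (ii)] -/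
private theorem core_of_unit₇ (hm : m = 6 * n) (hn : n = 3 ^ k) (hk : 3 ≤ k) {s : Multiset (ZMod m)}
    (hs : IsHodgeMultiset s) (hcard : card s = 4) (hpf : ¬ HasPair s) {x₀ y : ZMod m} (hy : y ∈ s)
    (hy2 : ¬ 2 ∣ y.val) (hy3 : ¬ 3 ∣ y.val) (hx : 2 * x₀ = y + 3 * 𝔫) (hx2 : ¬ 2 ∣ x₀.val) :
    (1 ≤ count (y + 2 * 𝔫) s ∧ 1 ≤ count (y + 4 * 𝔫) s) ∨
    (1 ≤ count (y + 3 * 𝔫) s ∧ 1 ≤ count (-(2 * y)) s) ∨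
    (1 ≤ count (y + 3 * 𝔫) s ∧ 1 ≤ count (2 * y + 3 * 𝔫) s ∧ 1 ≤ count (-(4 * y)) s) ∨
    (count (x₀) s = 1 ∧ 1 ≤ count (-(2 * y)) s) ∨
    (1 ≤ count (x₀) s ∧ 1 ≤ count (2 * y + 2 * 𝔫) s ∧ 1 ≤ count (2 * y + 4 * 𝔫) s) ∨
    (1 ≤ count (x₀) s ∧ 1 ≤ count (2 * y + 3 * 𝔫) s ∧ 1 ≤ count (-(4 * y)) s) ∨
    (1 ≤ count (x₀) s ∧ 1 ≤ count (2 * y + 3 * 𝔫) s ∧ 1 ≤ count (4 * y + 3 * 𝔫) s) ∨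
    (1 ≤ count (-(x₀ + 2 * 𝔫)) s ∧ 1 ≤ count (-(x₀ + 4 * 𝔫)) s ∧ 1 ≤ count (-(2 * y)) s) ∨
    (1 ≤ count (-(x₀ + 2 * 𝔫)) s ∧ 1 ≤ count (y + 2 * 𝔫) s ∧ 1 ≤ count (2 * y + 2 * 𝔫) s) ∨
    (1 ≤ count (-(x₀ + 2 * 𝔫)) s ∧ 1 ≤ count (-(y + 5 * 𝔫)) s ∧ 1 ≤ count (-(2 * y)) s) ∨
    (1 ≤ count (-(x₀ + 4 * 𝔫)) s ∧ 1 ≤ count (-(y + 𝔫)) s ∧ 1 ≤ count (-(2 * y)) s) ∨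
    (1 ≤ count (-(x₀ + 4 * 𝔫)) s ∧ 1 ≤ count (y + 4 * 𝔫) s ∧ 1 ≤ count (2 * y + 4 * 𝔫) s) ∨
    (1 ≤ count (-(y + 𝔫)) s ∧ 1 ≤ count (y + 2 * 𝔫) s ∧ 1 ≤ count (2 * y + 2 * 𝔫) s) ∨
    (1 ≤ count (-(y + 𝔫)) s ∧ 1 ≤ count (-(y + 5 * 𝔫)) s ∧ 1 ≤ count (-(2 * y)) s) ∨
    (1 ≤ count (y + 3 * 𝔫) s ∧ 1 ≤ count (2 * y + 2 * 𝔫) s ∧ 1 ≤ count (2 * y + 4 * 𝔫) s) ∨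
    (1 ≤ count (y + 3 * 𝔫) s ∧ 1 ≤ count (2 * y + 3 * 𝔫) s ∧ 1 ≤ count (4 * y + 3 * 𝔫) s) ∨
    (1 ≤ count (y + 4 * 𝔫) s ∧ 1 ≤ count (-(y + 5 * 𝔫)) s ∧ 1 ≤ count (2 * y + 4 * 𝔫) s) := by
  have hn0 : 0 < n := n_pos₇ hn
  have hk1 : 1 ≤ k := by omega
  have h3 := three_dvd_n₇ hn hk1
  have h6 := six_mul_n₇ hm
  have hx3 : ¬ 3 ∣ x₀.val := prime_three_half₇ hm h3 hy3 hx
  have hinj := pt4₇_injective hm hn hk hy3 hx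
  have n0 : count (-y) s = 0 := count_neg_eq_zero_of_not_hasPair₇ hpf (ne_neg_of_prime_three₇ hm h3 hy3) hy
  -- the `Λ`-identities of the classes of `y`, `x₀`, `2y + 3n`
  obtain ⟨Ly1, Ly2⟩ := lambda_class_twiceThreePow hm hn hk1 hs hy2 hy3 (rfl : (2 : ZMod m) * y = 2 * y)
  obtain ⟨Lx1, Lx2⟩ := lambda_class_twiceThreePow hm hn hk1 hs hx2 hx3 hx
  have f1 : y + 3 * 𝔫 + 3 * 𝔫 = y := by linear_combination h6
  have f2 : y + 3 * 𝔫 + 4 * 𝔫 = y + 𝔫 := by linear_combination h6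
  have f3 : y + 3 * 𝔫 + 𝔫 = y + 4 * 𝔫 := by ring
  have f4 : y + 3 * 𝔫 + 2 * 𝔫 = y + 5 * 𝔫 := by ring
  have f5 : y + 3 * 𝔫 + 5 * 𝔫 = y + 2 * 𝔫 := by linear_combination h6
  rw [f1, f2, f3] at Lx1
  rw [f2, f3, f4, f5] at Lx2
  have hz2 : ¬ 2 ∣ ((2 : ZMod m) * y + 3 * 𝔫).val := by simpa using odd_two_mul_add₇ hm hn y (j := 3) (by norm_num)
  have hz3 : ¬ 3 ∣ ((2 : ZMod m) * y + 3 * 𝔫).val := by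
    simpa using prime_three_add_mul_n₇ hm h3 (prime_three_two_mul₇ hm hy3) 3
  have hw : (2 : ZMod m) * (2 * y + 3 * 𝔫) = 4 * y := by linear_combination h6
  obtain ⟨Ls1, Ls2⟩ := lambda_class_twiceThreePow hm hn hk1 hs hz2 hz3 hw
  have g1 : (2 : ZMod m) * y + 3 * 𝔫 + 2 * 𝔫 = 2 * y + 5 * 𝔫 := by ring
  have g2 : (2 : ZMod m) * y + 3 * 𝔫 + 4 * 𝔫 = 2 * y + 𝔫 := by linear_combination h6
  rw [g1] at Ls1
  rw [g1, g2] at Ls2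
  -- `s = {y, t₁, t₂, t₃}` and the token types
  obtain ⟨t, rfl⟩ := Multiset.exists_cons_of_mem hy
  have ht : card t = 3 := by
    rw [Multiset.card_cons] at hcard
    omega
  obtain ⟨t₁, t₂, t₃, rfl⟩ := Multiset.card_eq_three.mp ht
  obtain ⟨T0, T2, T4, T6, T8, T10, T12, T13, T14, T15, T16, T17, T18, T19, T20, T21, T22, T23, T24, T25, T26, T27, T28, T29, T30, T31, T32, T33, T34, T35, T36, T37, T38, T39, T40, T41, T42, T43, T44, T45, T46, T47⟩ := P48_vals (n := n) x₀ y
  have HC : ∀ j < 48, count (P48 n x₀ y j) (y ::ₘ {t₁, t₂, t₃}) = cA (ty n x₀ y t₁) (ty n x₀ y t₂) (ty n x₀ y t₃) j :=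
    fun j hj ↦ count_P48 hinj T12 t₁ t₂ t₃ hj
  have c0 := HC 0 (by norm_num)
  rw [T0] at c0
  have c2 := HC 2 (by norm_num)
  rw [T2] at c2
  have c4 := HC 4 (by norm_num)
  rw [T4] at c4
  have c6 := HC 6 (by norm_num)
  rw [T6] at c6
  have c8 := HC 8 (by norm_num)
  rw [T8] at c8
  have c10 := HC 10 (by norm_num)
  rw [T10] at c10
  have c12 := HC 12 (by norm_num)
  rw [T12] at c12
  have c13 := HC 13 (by norm_num)
  rw [T13] at c13
  have c14 := HC 14 (by norm_num)
  rw [T14] at c14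
  have c15 := HC 15 (by norm_num)
  rw [T15] at c15
  have c16 := HC 16 (by norm_num)
  rw [T16] at c16
  have c17 := HC 17 (by norm_num)
  rw [T17] at c17
  have c18 := HC 18 (by norm_num)
  rw [T18] at c18
  have c19 := HC 19 (by norm_num)
  rw [T19] at c19
  have c20 := HC 20 (by norm_num)
  rw [T20] at c20
  have c21 := HC 21 (by norm_num)
  rw [T21] at c21
  have c22 := HC 22 (by norm_num)
  rw [T22] at c22
  have c23 := HC 23 (by norm_num)
  rw [T23] at c23
  have c24 := HC 24 (by norm_num)
  rw [T24] at c24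
  have c25 := HC 25 (by norm_num)
  rw [T25] at c25
  have c26 := HC 26 (by norm_num)
  rw [T26] at c26
  have c27 := HC 27 (by norm_num)
  rw [T27] at c27
  have c28 := HC 28 (by norm_num)
  rw [T28] at c28
  have c29 := HC 29 (by norm_num)
  rw [T29] at c29
  have c30 := HC 30 (by norm_num)
  rw [T30] at c30
  have c31 := HC 31 (by norm_num)
  rw [T31] at c31
  have c32 := HC 32 (by norm_num)
  rw [T32] at c32
  have c33 := HC 33 (by norm_num)
  rw [T33] at c33
  have c34 := HC 34 (by norm_num)
  rw [T34] at c34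
  have c35 := HC 35 (by norm_num)
  rw [T35] at c35
  have c36 := HC 36 (by norm_num)
  rw [T36] at c36
  have c37 := HC 37 (by norm_num)
  rw [T37] at c37
  have c38 := HC 38 (by norm_num)
  rw [T38] at c38
  have c39 := HC 39 (by norm_num)
  rw [T39] at c39
  have c40 := HC 40 (by norm_num)
  rw [T40] at c40
  have c41 := HC 41 (by norm_num)
  rw [T41] at c41
  have c42 := HC 42 (by norm_num)
  rw [T42] at c42
  have c43 := HC 43 (by norm_num)
  rw [T43] at c43
  have c44 := HC 44 (by norm_num)
  rw [T44] at c44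
  have c45 := HC 45 (by norm_num)
  rw [T45] at c45
  have c46 := HC 46 (by norm_num)
  rw [T46] at c46
  have c47 := HC 47 (by norm_num)
  rw [T47] at c47
  -- the abstract hypotheses hold
  have HYP : hypA (ty n x₀ y t₁) (ty n x₀ y t₂) (ty n x₀ y t₃) := by
    refine ⟨?_, ?_, ?_, ?_, ?_, ?_, ?_⟩
    · rw [← c12, ← c14, ← c18, ← c20, ← c24, ← c25, ← c27, ← c28, ← c30, ← c31, ← c33, ← c34]
      zify
      linear_combination Ly1
    · rw [← c14, ← c16, ← c20, ← c22, ← c25, ← c26, ← c28, ← c29, ← c31, ← c32, ← c34, ← c35]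
      zify
      linear_combination Ly2
    · rw [← c0, ← c2, ← c6, ← c8, ← c12, ← c13, ← c15, ← c16, ← c18, ← c19, ← c21, ← c22]
      zify
      linear_combination Lx1
    · rw [← c2, ← c4, ← c8, ← c10, ← c13, ← c14, ← c16, ← c17, ← c19, ← c20, ← c22, ← c23]
      zify
      linear_combination Lx2
    · rw [← c27, ← c29, ← c33, ← c35, ← c36, ← c37, ← c39, ← c40, ← c42, ← c43, ← c45, ← c46]
      zify
      linear_combination Ls1
    · rw [← c25, ← c29, ← c31, ← c35, ← c37, ← c38, ← c40, ← c41, ← c43, ← c44, ← c46, ← c47]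
      zify
      linear_combination Ls2
    · rw [← c18]
      exact n0
  -- the abstract decision, translated back
  have C := coreA_of_hypA (lt_of_le_of_lt (ty_le x₀ y t₁) (by norm_num)) (lt_of_le_of_lt (ty_le x₀ y t₂) (by norm_num))
    (lt_of_le_of_lt (ty_le x₀ y t₃) (by norm_num)) HYP
  unfold coreA at C
  rw [← c0, ← c8, ← c10, ← c14, ← c15, ← c16, ← c19, ← c23, ← c26, ← c27, ← c28, ← c30, ← c39, ← c42] at C
  exact C


/-! ### From the cores to the standard shapes: the zero sum -/

/-- `3 ∣ ⟨z⟩` gives `3 ∣ ⟨2z⟩`. [folklore] -/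
private theorem three_dvd_val_two_mul₇ (hm : m = 6 * n) {z : ZMod m} (h : 3 ∣ z.val) : 3 ∣ ((2 : ZMod m) * z).val := by
  rw [show (2 : ZMod m) * z = (((2 * z.val : ℕ)) : ZMod m) by push_cast; rw [ZMod.natCast_zmod_val], ZMod.val_natCast,
    Nat.dvd_mod_iff (three_dvd_m₇ hm)]
  exact Dvd.dvd.mul_left h 2

/-- **An even residue has an odd half** (`m = 6n`, `n` odd): the two halves `x`, `x + 3n` of `e` have different parities.
[folklore] -/
private theorem exists_odd_half₇ (hm : m = 6 * n) (hn : n = 3 ^ k) {e : ZMod m} (he : 2 ∣ e.val) :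
    ∃ x : ZMod m, 2 * x = e ∧ ¬ 2 ∣ x.val := by
  have hn0 : 0 < n := n_pos₇ hn
  have h2m := two_dvd_m₇ hm
  obtain ⟨c, hc⟩ := he
  have hx₁ : (2 : ZMod m) * (c : ZMod m) = e := by
    rw [show (2 : ZMod m) * (c : ZMod m) = (((2 * c : ℕ)) : ZMod m) by push_cast; ring, ← hc, ZMod.natCast_zmod_val]
  by_cases h : 2 ∣ ((c : ℕ) : ZMod m).val
  · refine ⟨(c : ZMod m) + 𝔥, by linear_combination hx₁ + h_add_h₇ hm, ?_⟩
    have hh : ¬ 2 ∣ (𝔥 : ZMod m).val := by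
      rw [val_h₇ hm hn0]
      intro h2
      rcases (Nat.Prime.dvd_mul Nat.prime_two).mp h2 with h2 | h2
      · omega
      · exact not_two_dvd_n₇ hn h2
    rw [dvd_val_iff_cast₇ h2m] at h hh ⊢
    rw [_root_.map_add, h, zero_add]
    exact hh
  · exact ⟨(c : ZMod m), hx₁, h⟩


omit [NeZero m] in
/-- Three distinct members of a `4`-multiset leave one more member. [folklore] -/
private theorem exists_eq_of_three_mem₇ {s : Multiset (ZMod m)} (hcard : card s = 4) {a b c : ZMod m}
    (ha : a ∈ s) (hb : b ∈ s) (hc : c ∈ s) (hab : a ≠ b) (hac : a ≠ c) (hbc : b ≠ c) :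
    ∃ t, s = a ::ₘ b ::ₘ c ::ₘ {t} := by
  have h1 : s = a ::ₘ s.erase a := (Multiset.cons_erase ha).symm
  have hb' : b ∈ s.erase a := (Multiset.mem_erase_of_ne hab.symm).mpr hb
  have h2 : s.erase a = b ::ₘ (s.erase a).erase b := (Multiset.cons_erase hb').symm
  have hc' : c ∈ (s.erase a).erase b :=
    (Multiset.mem_erase_of_ne hbc.symm).mpr ((Multiset.mem_erase_of_ne hac.symm).mpr hc)
  have h3 : (s.erase a).erase b = c ::ₘ ((s.erase a).erase b).erase c := (Multiset.cons_erase hc').symm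
  have hcard' : card (((s.erase a).erase b).erase c) = 1 := by
    rw [Multiset.card_erase_of_mem hc', Multiset.card_erase_of_mem hb', Multiset.card_erase_of_mem ha, hcard]
    rfl
  obtain ⟨t, ht⟩ := Multiset.card_eq_one.mp hcard'
  exact ⟨t, by rw [h1, h2, h3, ht]⟩

omit [NeZero m] in
/-- The sum of `{a, b, c, t}`. [folklore] -/
private theorem sum_four₇ (a b c t : ZMod m) : (a ::ₘ b ::ₘ c ::ₘ ({t} : Multiset (ZMod m))).sum = a + b + c + t := by
  simp only [Multiset.sum_cons, Multiset.sum_singleton]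
  ring

omit [NeZero m] in
/-- `{a, b, c, d} = {c, d, a, b}`. [folklore] -/
private theorem quad_rotate₇ (a b c d : ZMod m) :
    (a ::ₘ b ::ₘ c ::ₘ ({d} : Multiset (ZMod m))) = c ::ₘ d ::ₘ a ::ₘ {b} := by
  ext t
  simp only [Multiset.count_cons, Multiset.count_singleton]
  split_ifs <;> omega

/-- `2x = 0` in `ℤ/6n` forces `x ∈ {0, 3n}`. [folklore] -/
private theorem eq_zero_or_eq_h_of_two_mul₇ (hm : m = 6 * n) (hn0 : 0 < n) {x : ZMod m} (h : (2 : ZMod m) * x = 0) :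
    x = 0 ∨ x = 𝔥 := by
  have hv : (2 * x.val) % m = 0 := by
    have := congrArg ZMod.val h
    rw [ZMod.val_mul, ZMod.val_zero, show ((2 : ZMod m)).val = 2 by
      rw [show (2 : ZMod m) = ((2 : ℕ) : ZMod m) by norm_cast, ZMod.val_natCast, Nat.mod_eq_of_lt (by omega)]] at this
    exact this
  have hx := ZMod.val_lt x
  by_cases hlt : 2 * x.val < m
  · left
    rw [Nat.mod_eq_of_lt hlt] at hv
    apply ZMod.val_injective m
    rw [ZMod.val_zero]
    omega
  · right
    apply ZMod.val_injective m
    rw [val_h₇ hm hn0]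
    rw [Nat.mod_eq_sub_mod (by omega), Nat.mod_eq_of_lt (by omega)] at hv
    omega

/-- **`c·y + j·n ≠ 0`** for `y` prime to `3` and `3 ∤ c` (`3 ∣ n`): reduce modulo `3`. [folklore] -/
private theorem natMul_add_ne_zero₇ (hm : m = 6 * n) (h3 : 3 ∣ n) {y : ZMod m} (hy3 : ¬ 3 ∣ y.val) {c : ℕ} (hc : ¬ 3 ∣ c)
    (j : ℕ) : (c : ZMod m) * y + ((j : ℕ) : ZMod m) * 𝔫 ≠ 0 := by
  intro h
  have h3m := three_dvd_m₇ hm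
  set ρ := ZMod.castHom h3m (ZMod 3) with hρ
  have hn3 : ρ (((j : ℕ) : ZMod m) * 𝔫) = 0 := (dvd_val_iff_cast₇ h3m _).mp (three_dvd_val_mul_n₇ hm h3 j)
  have hy' : ρ y ≠ 0 := fun e ↦ hy3 ((dvd_val_iff_cast₇ h3m y).mpr e)
  have hc' : ((c : ℕ) : ZMod 3) ≠ 0 := by rwa [Ne, ZMod.natCast_eq_zero_iff]
  have e := congrArg ρ h
  rw [_root_.map_add, hn3, add_zero, _root_.map_mul, map_natCast, _root_.map_zero] at e
  rcases mul_eq_zero.mp e with h0 | h0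
  · exact hc' h0
  · exact hy' h0

/-- **`3·(c·y + j·n) ≠ 0`** for `y` prime to `3` and `3 ∤ c` (`m = 2·3ᵏ⁺¹`, `k ≥ 1`): `3w = 0` forces `2n ∣ ⟨w⟩`, so
`3 ∣ ⟨w⟩`, and `w = c·y + j·n` reduces to `c·y ≠ 0` modulo `3`. [folklore] -/
private theorem three_mul_natMul_add_ne_zero₇ (hm : m = 6 * n) (hn : n = 3 ^ k) (hk : 1 ≤ k) {y : ZMod m}
    (hy3 : ¬ 3 ∣ y.val) {c : ℕ} (hc : ¬ 3 ∣ c) (j : ℕ) : (3 : ZMod m) * ((c : ZMod m) * y + ((j : ℕ) : ZMod m) * 𝔫) ≠ 0 := by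
  have h3 := three_dvd_n₇ hn hk
  set w := (c : ZMod m) * y + ((j : ℕ) : ZMod m) * 𝔫 with hw
  intro h
  have h3w : 3 ∣ w.val := by
    rw [show (3 : ZMod m) * w = (((3 * w.val : ℕ)) : ZMod m) by push_cast; rw [ZMod.natCast_zmod_val],
      ZMod.natCast_eq_zero_iff] at h
    have hm' : 3 * (2 * n) ∣ m := ⟨1, by rw [hm]; ring⟩
    exact dvd_trans (dvd_trans h3 (Dvd.intro_left 2 rfl)) (Nat.dvd_of_mul_dvd_mul_left three_pos (dvd_trans hm' h))
  have h3m := three_dvd_m₇ hm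
  set ρ := ZMod.castHom h3m (ZMod 3) with hρ
  have hn3 : ρ (((j : ℕ) : ZMod m) * 𝔫) = 0 := (dvd_val_iff_cast₇ h3m _).mp (three_dvd_val_mul_n₇ hm h3 j)
  have hy' : ρ y ≠ 0 := fun e ↦ hy3 ((dvd_val_iff_cast₇ h3m y).mpr e)
  have hc' : ((c : ℕ) : ZMod 3) ≠ 0 := by rwa [Ne, ZMod.natCast_eq_zero_iff]
  have e : ρ w = 0 := (dvd_val_iff_cast₇ h3m w).mp h3w
  rw [hw, _root_.map_add, hn3, add_zero, _root_.map_mul, map_natCast] at e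
  rcases mul_eq_zero.mp e with h0 | h0
  · exact hc' h0
  · exact hy' h0

/-- `2y ≠ 3n` (parities). [folklore] -/
private theorem two_mul_ne_three_mul_n₇ (hm : m = 6 * n) (hn : n = 3 ^ k) (y : ZMod m) : (2 : ZMod m) * y ≠ 3 * 𝔫 := by
  intro h
  have h2 := two_dvd_val_two_mul₇ hm y
  rw [h] at h2
  have := odd_two_mul_add₇ hm hn 0 (j := 3) (by norm_num)
  simp only [mul_zero, zero_add, Nat.cast_ofNat] at this
  exact this h2

/-- `y + 3n` is even for odd `y`. [folklore] -/
private theorem two_dvd_val_add_three_mul_n₇ (hm : m = 6 * n) (hn : n = 3 ^ k) {y : ZMod m} (hy2 : ¬ 2 ∣ y.val) :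
    2 ∣ (y + 3 * 𝔫).val := by
  have h2m := two_dvd_m₇ hm
  have hodd : ¬ 2 ∣ ((3 : ZMod m) * 𝔫).val := by
    have := odd_two_mul_add₇ hm hn 0 (j := 3) (by norm_num)
    simpa using this
  rw [dvd_val_iff_cast₇ h2m] at hy2 hodd ⊢
  rw [_root_.map_add]
  have key : ∀ a b : ZMod 2, a ≠ 0 → b ≠ 0 → a + b = 0 := by decide
  exact key _ _ hy2 hodd

/-- The shape theorem with the odd half `x₀` of `y + 3n` as a parameter. [cite: Aoki1983, Thm. C p. 47] -/
private theorem shape_of_unit₇ (hm : m = 6 * n) (hn : n = 3 ^ k) (hk : 3 ≤ k) {s : Multiset (ZMod m)}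
    (hs : IsHodgeMultiset s) (hcard : card s = 4) (hpf : ¬ HasPair s) {x₀ y : ZMod m} (hy : y ∈ s)
    (hy2 : ¬ 2 ∣ y.val) (hy3 : ¬ 3 ∣ y.val) (hx : 2 * x₀ = y + 3 * 𝔫) (hx2 : ¬ 2 ∣ x₀.val) :
    s = {y, y + 2 * 𝔫, y + 4 * 𝔫, -(3 * y)} ∨ s = {y, y + 3 * 𝔫, -(2 * y), 3 * 𝔫} ∨
      s = {y, y + 3 * 𝔫, 2 * y + 3 * 𝔫, -(4 * y)} ∨ s = {x₀, x₀ + 3 * 𝔫, 2 * x₀ + 3 * 𝔫, -(4 * x₀)} := by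
  have hn0 : 0 < n := n_pos₇ hn
  have hk1 : 1 ≤ k := by omega
  have h3 := three_dvd_n₇ hn hk1
  have h6 := six_mul_n₇ hm
  have hsum : s.sum = 0 := hs.1.2
  have hinj := pt4₇_injective hm hn hk hy3 hx
  obtain ⟨T0, T2, T4, T6, T8, T10, T12, T13, T14, T15, T16, T17, T18, T19, T20, T21, T22, T23, T24, T25, T26, T27, T28, T29, T30, T31, T32, T33, T34, T35, T36, T37, T38, T39, T40, T41, T42, T43, T44, T45, T46, T47⟩ := P48_vals (n := n) x₀ y
  have NE : ∀ {j j' : ℕ} {a b : ZMod m}, j < 48 → j' < 48 → j ≠ j' → P48 n x₀ y j = a → P48 n x₀ y j' = b → a ≠ b := by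
    rintro j j' a b hj hj' hjj' rfl rfl h
    exact hjj' (P48_inj hinj hj hj' h)
  have mem : ∀ {p : ZMod m}, 1 ≤ count p s → p ∈ s := fun h ↦ Multiset.count_pos.mp (by omega)
  have EV1 : 2 ∣ (y + 3 * 𝔫).val := two_dvd_val_add_three_mul_n₇ hm hn hy2
  have EV2 : 2 ∣ ((4 : ZMod m) * y + 2 * 𝔫).val := by
    rw [show (4 : ZMod m) * y + 2 * 𝔫 = 2 * (2 * y + 𝔫) by ring]; exact two_dvd_val_two_mul₇ hm _
  have EV3 : 2 ∣ ((4 : ZMod m) * y + 4 * 𝔫).val := by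
    rw [show (4 : ZMod m) * y + 4 * 𝔫 = 2 * (2 * y + 2 * 𝔫) by ring]; exact two_dvd_val_two_mul₇ hm _
  rcases core_of_unit₇ hm hn hk hs hcard hpf hy hy2 hy3 hx hx2 with
    ⟨c14, c16⟩ | ⟨c15, c30⟩ | ⟨c15, c27, c42⟩ | ⟨c0, c30⟩ | ⟨c0, c26, c28⟩ | ⟨c0, c27, c42⟩ | ⟨c0, c27, c39⟩ | ⟨c8, c10, c30⟩ | ⟨c8, c14, c26⟩ | ⟨c8, c23, c30⟩ | ⟨c10, c19, c30⟩ | ⟨c10, c16, c28⟩ | ⟨c19, c14, c26⟩ | ⟨c19, c23, c30⟩ | ⟨c15, c26, c28⟩ | ⟨c15, c27, c39⟩ | ⟨c16, c23, c28⟩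
  · -- `γ_y`
    obtain ⟨t, ht⟩ := exists_eq_of_three_mem₇ hcard hy (mem c14) (mem c16) (NE (by norm_num : (12:ℕ) < 48) (by norm_num : (14:ℕ) < 48) (by norm_num) T12 T14) (NE (by norm_num : (12:ℕ) < 48) (by norm_num : (16:ℕ) < 48) (by norm_num) T12 T16)
      (NE (by norm_num : (14:ℕ) < 48) (by norm_num : (16:ℕ) < 48) (by norm_num) T14 T16)
    have hs4 := hsum
    rw [ht, sum_four₇] at hs4
    have e : t = -(3 * y) := by linear_combination hs4 - h6
    exact Or.inl (by rw [ht, e]; rfl)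
  · -- `α_y`
    obtain ⟨t, ht⟩ := exists_eq_of_three_mem₇ hcard hy (mem c15) (mem c30) (NE (by norm_num : (12:ℕ) < 48) (by norm_num : (15:ℕ) < 48) (by norm_num) T12 T15) (NE (by norm_num : (12:ℕ) < 48) (by norm_num : (30:ℕ) < 48) (by norm_num) T12 T30)
      (NE (by norm_num : (15:ℕ) < 48) (by norm_num : (30:ℕ) < 48) (by norm_num) T15 T30)
    have hs4 := hsum
    rw [ht, sum_four₇] at hs4
    have e : t = 3 * 𝔫 := by linear_combination hs4 - h6
    exact Or.inr (Or.inl (by rw [ht, e]; rfl))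
  · -- `β_y`
    obtain ⟨t, ht⟩ := exists_eq_of_three_mem₇ hcard hy (mem c15) (mem c27) (NE (by norm_num : (12:ℕ) < 48) (by norm_num : (15:ℕ) < 48) (by norm_num) T12 T15) (NE (by norm_num : (12:ℕ) < 48) (by norm_num : (27:ℕ) < 48) (by norm_num) T12 T27)
      (NE (by norm_num : (15:ℕ) < 48) (by norm_num : (27:ℕ) < 48) (by norm_num) T15 T27)
    have hs4 := hsum
    rw [ht, sum_four₇] at hs4
    have e : t = -(4 * y) := by linear_combination hs4 - h6
    exact Or.inr (Or.inr (Or.inl (by rw [ht, e]; rfl)))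
  · -- `β_{x₀}`: `s = {y, −2y, x₀, t}`, `t = y − x₀`, and `2(t − x₀ − 3n) = 0` leaves `t = x₀ + 3n` (`t = x₀` would repeat `x₀`)
    have hx₀ : x₀ ∈ s := mem (by omega)
    obtain ⟨t, ht⟩ := exists_eq_of_three_mem₇ hcard hy (mem c30) hx₀ (NE (by norm_num : (12:ℕ) < 48) (by norm_num : (30:ℕ) < 48) (by norm_num) T12 T30) (NE (by norm_num : (12:ℕ) < 48) (by norm_num : (0:ℕ) < 48) (by norm_num) T12 T0)
      (NE (by norm_num : (30:ℕ) < 48) (by norm_num : (0:ℕ) < 48) (by norm_num) T30 T0)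
    have hs4 := hsum
    rw [ht, sum_four₇] at hs4
    have h2 : (2 : ZMod m) * (t - x₀ - 3 * 𝔫) = 0 := by linear_combination 2 * hs4 - 2 * hx - 2 * h6
    rcases eq_zero_or_eq_h_of_two_mul₇ hm hn0 h2 with h0 | hh
    · have e : t = x₀ + 3 * 𝔫 := by linear_combination h0
      have ey : y = 2 * x₀ + 3 * 𝔫 := by linear_combination -hx - h6
      have e2 : -(2 * y) = -(4 * x₀) := by linear_combination 2 * hx + h6
      refine Or.inr (Or.inr (Or.inr ?_))
      rw [ht, e, quad_rotate₇]
      -- `x₀ ::ₘ (x₀ + 3n) ::ₘ y ::ₘ {−2y}` with `y = 2x₀ + 3n`, `−2y = −4x₀`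
      rw [ey] at e2 ⊢
      rw [e2]
      rfl
    · have e : t = x₀ := by
        rw [h_eq_three_mul₇.1] at hh
        linear_combination hh + h6
      rw [e] at ht
      have : 2 ≤ count x₀ s := by
        rw [ht]
        simp only [Multiset.count_cons, Multiset.count_singleton, if_true]
        split_ifs <;> omega
      omega
  · -- spurious core {y, x₀, 2 * y + 2 * 𝔫, 2 * y + 4 * 𝔫}: the zero sum is impossible
    obtain ⟨t, ht⟩ := exists_eq_of_three_mem₇ hcard hy (mem c0) (mem c26) (NE (by norm_num : (12:ℕ) < 48) (by norm_num : (0:ℕ) < 48) (by norm_num) T12 T0) (NE (by norm_num : (12:ℕ) < 48) (by norm_num : (26:ℕ) < 48) (by norm_num) T12 T26)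
      (NE (by norm_num : (0:ℕ) < 48) (by norm_num : (26:ℕ) < 48) (by norm_num) T0 T26)
    have h4 : 2 * y + 4 * 𝔫 ∈ s := mem c28
    rw [ht] at h4
    have ht4 : t = 2 * y + 4 * 𝔫 := by
      simp only [Multiset.mem_cons, Multiset.mem_singleton] at h4
      rcases h4 with h | h | h | h
      · exact absurd h.symm (NE (by norm_num : (12:ℕ) < 48) (by norm_num : (28:ℕ) < 48) (by norm_num) T12 T28)
      · exact absurd h.symm (NE (by norm_num : (0:ℕ) < 48) (by norm_num : (28:ℕ) < 48) (by norm_num) T0 T28)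
      · exact absurd h.symm (NE (by norm_num : (26:ℕ) < 48) (by norm_num : (28:ℕ) < 48) (by norm_num) T26 T28)
      · exact h.symm
    have hs4 := hsum
    rw [ht, sum_four₇, ht4] at hs4
    exact (natMul_add_ne_zero₇ hm h3 hy3 (c := 11) (by norm_num) 3
      (by push_cast; linear_combination 2 * hs4 - hx - 2 * h6)).elim
  · -- spurious core {y, x₀, 2 * y + 3 * 𝔫, -(4 * y)}: the zero sum is impossible
    obtain ⟨t, ht⟩ := exists_eq_of_three_mem₇ hcard hy (mem c0) (mem c27) (NE (by norm_num : (12:ℕ) < 48) (by norm_num : (0:ℕ) < 48) (by norm_num) T12 T0) (NE (by norm_num : (12:ℕ) < 48) (by norm_num : (27:ℕ) < 48) (by norm_num) T12 T27)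
      (NE (by norm_num : (0:ℕ) < 48) (by norm_num : (27:ℕ) < 48) (by norm_num) T0 T27)
    have h4 : -(4 * y) ∈ s := mem c42
    rw [ht] at h4
    have ht4 : t = -(4 * y) := by
      simp only [Multiset.mem_cons, Multiset.mem_singleton] at h4
      rcases h4 with h | h | h | h
      · exact absurd h.symm (NE (by norm_num : (12:ℕ) < 48) (by norm_num : (42:ℕ) < 48) (by norm_num) T12 T42)
      · exact absurd h.symm (NE (by norm_num : (0:ℕ) < 48) (by norm_num : (42:ℕ) < 48) (by norm_num) T0 T42)
      · exact absurd h.symm (NE (by norm_num : (27:ℕ) < 48) (by norm_num : (42:ℕ) < 48) (by norm_num) T27 T42)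
      · exact h.symm
    have hs4 := hsum
    rw [ht, sum_four₇, ht4] at hs4
    exact (hx2 (by rw [show x₀ = y + 3 * 𝔫 by linear_combination hs4 - h6]; exact EV1)).elim
  · -- spurious core {y, x₀, 2 * y + 3 * 𝔫, 4 * y + 3 * 𝔫}: the zero sum is impossible
    obtain ⟨t, ht⟩ := exists_eq_of_three_mem₇ hcard hy (mem c0) (mem c27) (NE (by norm_num : (12:ℕ) < 48) (by norm_num : (0:ℕ) < 48) (by norm_num) T12 T0) (NE (by norm_num : (12:ℕ) < 48) (by norm_num : (27:ℕ) < 48) (by norm_num) T12 T27)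
      (NE (by norm_num : (0:ℕ) < 48) (by norm_num : (27:ℕ) < 48) (by norm_num) T0 T27)
    have h4 : 4 * y + 3 * 𝔫 ∈ s := mem c39
    rw [ht] at h4
    have ht4 : t = 4 * y + 3 * 𝔫 := by
      simp only [Multiset.mem_cons, Multiset.mem_singleton] at h4
      rcases h4 with h | h | h | h
      · exact absurd h.symm (NE (by norm_num : (12:ℕ) < 48) (by norm_num : (39:ℕ) < 48) (by norm_num) T12 T39)
      · exact absurd h.symm (NE (by norm_num : (0:ℕ) < 48) (by norm_num : (39:ℕ) < 48) (by norm_num) T0 T39)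
      · exact absurd h.symm (NE (by norm_num : (27:ℕ) < 48) (by norm_num : (39:ℕ) < 48) (by norm_num) T27 T39)
      · exact h.symm
    have hs4 := hsum
    rw [ht, sum_four₇, ht4] at hs4
    exact (three_mul_natMul_add_ne_zero₇ hm hn hk1 hy3 (c := 5) (by norm_num) 1
      (by push_cast; linear_combination 2 * hs4 - hx - 2 * h6)).elim
  · -- spurious core {y, -(x₀ + 2 * 𝔫), -(x₀ + 4 * 𝔫), -(2 * y)}: the zero sum is impossible
    obtain ⟨t, ht⟩ := exists_eq_of_three_mem₇ hcard hy (mem c8) (mem c10) (NE (by norm_num : (12:ℕ) < 48) (by norm_num : (8:ℕ) < 48) (by norm_num) T12 T8) (NE (by norm_num : (12:ℕ) < 48) (by norm_num : (10:ℕ) < 48) (by norm_num) T12 T10)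
      (NE (by norm_num : (8:ℕ) < 48) (by norm_num : (10:ℕ) < 48) (by norm_num) T8 T10)
    have h4 : -(2 * y) ∈ s := mem c30
    rw [ht] at h4
    have ht4 : t = -(2 * y) := by
      simp only [Multiset.mem_cons, Multiset.mem_singleton] at h4
      rcases h4 with h | h | h | h
      · exact absurd h.symm (NE (by norm_num : (12:ℕ) < 48) (by norm_num : (30:ℕ) < 48) (by norm_num) T12 T30)
      · exact absurd h.symm (NE (by norm_num : (8:ℕ) < 48) (by norm_num : (30:ℕ) < 48) (by norm_num) T8 T30)
      · exact absurd h.symm (NE (by norm_num : (10:ℕ) < 48) (by norm_num : (30:ℕ) < 48) (by norm_num) T10 T30)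
      · exact h.symm
    have hs4 := hsum
    rw [ht, sum_four₇, ht4] at hs4
    exact (two_mul_ne_three_mul_n₇ hm hn y (by linear_combination -hs4 - hx - 2 * h6)).elim
  · -- spurious core {y, -(x₀ + 2 * 𝔫), y + 2 * 𝔫, 2 * y + 2 * 𝔫}: the zero sum is impossible
    obtain ⟨t, ht⟩ := exists_eq_of_three_mem₇ hcard hy (mem c8) (mem c14) (NE (by norm_num : (12:ℕ) < 48) (by norm_num : (8:ℕ) < 48) (by norm_num) T12 T8) (NE (by norm_num : (12:ℕ) < 48) (by norm_num : (14:ℕ) < 48) (by norm_num) T12 T14)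
      (NE (by norm_num : (8:ℕ) < 48) (by norm_num : (14:ℕ) < 48) (by norm_num) T8 T14)
    have h4 : 2 * y + 2 * 𝔫 ∈ s := mem c26
    rw [ht] at h4
    have ht4 : t = 2 * y + 2 * 𝔫 := by
      simp only [Multiset.mem_cons, Multiset.mem_singleton] at h4
      rcases h4 with h | h | h | h
      · exact absurd h.symm (NE (by norm_num : (12:ℕ) < 48) (by norm_num : (26:ℕ) < 48) (by norm_num) T12 T26)
      · exact absurd h.symm (NE (by norm_num : (8:ℕ) < 48) (by norm_num : (26:ℕ) < 48) (by norm_num) T8 T26)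
      · exact absurd h.symm (NE (by norm_num : (14:ℕ) < 48) (by norm_num : (26:ℕ) < 48) (by norm_num) T14 T26)
      · exact h.symm
    have hs4 := hsum
    rw [ht, sum_four₇, ht4] at hs4
    exact (hx2 (by rw [show x₀ = 4 * y + 2 * 𝔫 by linear_combination -hs4]; exact EV2)).elim
  · -- spurious core {y, -(x₀ + 2 * 𝔫), -(y + 5 * 𝔫), -(2 * y)}: the zero sum is impossible
    obtain ⟨t, ht⟩ := exists_eq_of_three_mem₇ hcard hy (mem c8) (mem c23) (NE (by norm_num : (12:ℕ) < 48) (by norm_num : (8:ℕ) < 48) (by norm_num) T12 T8) (NE (by norm_num : (12:ℕ) < 48) (by norm_num : (23:ℕ) < 48) (by norm_num) T12 T23)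
      (NE (by norm_num : (8:ℕ) < 48) (by norm_num : (23:ℕ) < 48) (by norm_num) T8 T23)
    have h4 : -(2 * y) ∈ s := mem c30
    rw [ht] at h4
    have ht4 : t = -(2 * y) := by
      simp only [Multiset.mem_cons, Multiset.mem_singleton] at h4
      rcases h4 with h | h | h | h
      · exact absurd h.symm (NE (by norm_num : (12:ℕ) < 48) (by norm_num : (30:ℕ) < 48) (by norm_num) T12 T30)
      · exact absurd h.symm (NE (by norm_num : (8:ℕ) < 48) (by norm_num : (30:ℕ) < 48) (by norm_num) T8 T30)
      · exact absurd h.symm (NE (by norm_num : (23:ℕ) < 48) (by norm_num : (30:ℕ) < 48) (by norm_num) T23 T30)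
      · exact h.symm
    have hs4 := hsum
    rw [ht, sum_four₇, ht4] at hs4
    exact (natMul_add_ne_zero₇ hm h3 hy3 (c := 5) (by norm_num) 5
      (by push_cast; linear_combination -2 * hs4 - hx - 2 * h6)).elim
  · -- spurious core {y, -(x₀ + 4 * 𝔫), -(y + 𝔫), -(2 * y)}: the zero sum is impossible
    obtain ⟨t, ht⟩ := exists_eq_of_three_mem₇ hcard hy (mem c10) (mem c19) (NE (by norm_num : (12:ℕ) < 48) (by norm_num : (10:ℕ) < 48) (by norm_num) T12 T10) (NE (by norm_num : (12:ℕ) < 48) (by norm_num : (19:ℕ) < 48) (by norm_num) T12 T19)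
      (NE (by norm_num : (10:ℕ) < 48) (by norm_num : (19:ℕ) < 48) (by norm_num) T10 T19)
    have h4 : -(2 * y) ∈ s := mem c30
    rw [ht] at h4
    have ht4 : t = -(2 * y) := by
      simp only [Multiset.mem_cons, Multiset.mem_singleton] at h4
      rcases h4 with h | h | h | h
      · exact absurd h.symm (NE (by norm_num : (12:ℕ) < 48) (by norm_num : (30:ℕ) < 48) (by norm_num) T12 T30)
      · exact absurd h.symm (NE (by norm_num : (10:ℕ) < 48) (by norm_num : (30:ℕ) < 48) (by norm_num) T10 T30)
      · exact absurd h.symm (NE (by norm_num : (19:ℕ) < 48) (by norm_num : (30:ℕ) < 48) (by norm_num) T19 T30)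
      · exact h.symm
    have hs4 := hsum
    rw [ht, sum_four₇, ht4] at hs4
    exact (natMul_add_ne_zero₇ hm h3 hy3 (c := 5) (by norm_num) 1
      (by push_cast; linear_combination -2 * hs4 - hx - 2 * h6)).elim
  · -- spurious core {y, -(x₀ + 4 * 𝔫), y + 4 * 𝔫, 2 * y + 4 * 𝔫}: the zero sum is impossible
    obtain ⟨t, ht⟩ := exists_eq_of_three_mem₇ hcard hy (mem c10) (mem c16) (NE (by norm_num : (12:ℕ) < 48) (by norm_num : (10:ℕ) < 48) (by norm_num) T12 T10) (NE (by norm_num : (12:ℕ) < 48) (by norm_num : (16:ℕ) < 48) (by norm_num) T12 T16)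
      (NE (by norm_num : (10:ℕ) < 48) (by norm_num : (16:ℕ) < 48) (by norm_num) T10 T16)
    have h4 : 2 * y + 4 * 𝔫 ∈ s := mem c28
    rw [ht] at h4
    have ht4 : t = 2 * y + 4 * 𝔫 := by
      simp only [Multiset.mem_cons, Multiset.mem_singleton] at h4
      rcases h4 with h | h | h | h
      · exact absurd h.symm (NE (by norm_num : (12:ℕ) < 48) (by norm_num : (28:ℕ) < 48) (by norm_num) T12 T28)
      · exact absurd h.symm (NE (by norm_num : (10:ℕ) < 48) (by norm_num : (28:ℕ) < 48) (by norm_num) T10 T28)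
      · exact absurd h.symm (NE (by norm_num : (16:ℕ) < 48) (by norm_num : (28:ℕ) < 48) (by norm_num) T16 T28)
      · exact h.symm
    have hs4 := hsum
    rw [ht, sum_four₇, ht4] at hs4
    exact (hx2 (by rw [show x₀ = 4 * y + 4 * 𝔫 by linear_combination -hs4]; exact EV3)).elim
  · -- spurious core {y, -(y + 𝔫), y + 2 * 𝔫, 2 * y + 2 * 𝔫}: the zero sum is impossible
    obtain ⟨t, ht⟩ := exists_eq_of_three_mem₇ hcard hy (mem c19) (mem c14) (NE (by norm_num : (12:ℕ) < 48) (by norm_num : (19:ℕ) < 48) (by norm_num) T12 T19) (NE (by norm_num : (12:ℕ) < 48) (by norm_num : (14:ℕ) < 48) (by norm_num) T12 T14)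
      (NE (by norm_num : (19:ℕ) < 48) (by norm_num : (14:ℕ) < 48) (by norm_num) T19 T14)
    have h4 : 2 * y + 2 * 𝔫 ∈ s := mem c26
    rw [ht] at h4
    have ht4 : t = 2 * y + 2 * 𝔫 := by
      simp only [Multiset.mem_cons, Multiset.mem_singleton] at h4
      rcases h4 with h | h | h | h
      · exact absurd h.symm (NE (by norm_num : (12:ℕ) < 48) (by norm_num : (26:ℕ) < 48) (by norm_num) T12 T26)
      · exact absurd h.symm (NE (by norm_num : (19:ℕ) < 48) (by norm_num : (26:ℕ) < 48) (by norm_num) T19 T26)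
      · exact absurd h.symm (NE (by norm_num : (14:ℕ) < 48) (by norm_num : (26:ℕ) < 48) (by norm_num) T14 T26)
      · exact h.symm
    have hs4 := hsum
    rw [ht, sum_four₇, ht4] at hs4
    exact (three_mul_natMul_add_ne_zero₇ hm hn hk1 hy3 (c := 1) (by norm_num) 1
      (by push_cast; linear_combination hs4)).elim
  · -- spurious core {y, -(y + 𝔫), -(y + 5 * 𝔫), -(2 * y)}: the zero sum is impossible
    obtain ⟨t, ht⟩ := exists_eq_of_three_mem₇ hcard hy (mem c19) (mem c23) (NE (by norm_num : (12:ℕ) < 48) (by norm_num : (19:ℕ) < 48) (by norm_num) T12 T19) (NE (by norm_num : (12:ℕ) < 48) (by norm_num : (23:ℕ) < 48) (by norm_num) T12 T23)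
      (NE (by norm_num : (19:ℕ) < 48) (by norm_num : (23:ℕ) < 48) (by norm_num) T19 T23)
    have h4 : -(2 * y) ∈ s := mem c30
    rw [ht] at h4
    have ht4 : t = -(2 * y) := by
      simp only [Multiset.mem_cons, Multiset.mem_singleton] at h4
      rcases h4 with h | h | h | h
      · exact absurd h.symm (NE (by norm_num : (12:ℕ) < 48) (by norm_num : (30:ℕ) < 48) (by norm_num) T12 T30)
      · exact absurd h.symm (NE (by norm_num : (19:ℕ) < 48) (by norm_num : (30:ℕ) < 48) (by norm_num) T19 T30)
      · exact absurd h.symm (NE (by norm_num : (23:ℕ) < 48) (by norm_num : (30:ℕ) < 48) (by norm_num) T23 T30)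
      · exact h.symm
    have hs4 := hsum
    rw [ht, sum_four₇, ht4] at hs4
    exact (three_mul_natMul_add_ne_zero₇ hm hn hk1 hy3 (c := 1) (by norm_num) 0
      (by push_cast; linear_combination -hs4 - h6)).elim
  · -- spurious core {y, y + 3 * 𝔫, 2 * y + 2 * 𝔫, 2 * y + 4 * 𝔫}: the zero sum is impossible
    obtain ⟨t, ht⟩ := exists_eq_of_three_mem₇ hcard hy (mem c15) (mem c26) (NE (by norm_num : (12:ℕ) < 48) (by norm_num : (15:ℕ) < 48) (by norm_num) T12 T15) (NE (by norm_num : (12:ℕ) < 48) (by norm_num : (26:ℕ) < 48) (by norm_num) T12 T26)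
      (NE (by norm_num : (15:ℕ) < 48) (by norm_num : (26:ℕ) < 48) (by norm_num) T15 T26)
    have h4 : 2 * y + 4 * 𝔫 ∈ s := mem c28
    rw [ht] at h4
    have ht4 : t = 2 * y + 4 * 𝔫 := by
      simp only [Multiset.mem_cons, Multiset.mem_singleton] at h4
      rcases h4 with h | h | h | h
      · exact absurd h.symm (NE (by norm_num : (12:ℕ) < 48) (by norm_num : (28:ℕ) < 48) (by norm_num) T12 T28)
      · exact absurd h.symm (NE (by norm_num : (15:ℕ) < 48) (by norm_num : (28:ℕ) < 48) (by norm_num) T15 T28)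
      · exact absurd h.symm (NE (by norm_num : (26:ℕ) < 48) (by norm_num : (28:ℕ) < 48) (by norm_num) T26 T28)
      · exact h.symm
    have hs4 := hsum
    rw [ht, sum_four₇, ht4] at hs4
    exact (three_mul_natMul_add_ne_zero₇ hm hn hk1 hy3 (c := 2) (by norm_num) 1
      (by push_cast; linear_combination hs4 - h6)).elim
  · -- spurious core {y, y + 3 * 𝔫, 2 * y + 3 * 𝔫, 4 * y + 3 * 𝔫}: the zero sum is impossible
    obtain ⟨t, ht⟩ := exists_eq_of_three_mem₇ hcard hy (mem c15) (mem c27) (NE (by norm_num : (12:ℕ) < 48) (by norm_num : (15:ℕ) < 48) (by norm_num) T12 T15) (NE (by norm_num : (12:ℕ) < 48) (by norm_num : (27:ℕ) < 48) (by norm_num) T12 T27)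
      (NE (by norm_num : (15:ℕ) < 48) (by norm_num : (27:ℕ) < 48) (by norm_num) T15 T27)
    have h4 : 4 * y + 3 * 𝔫 ∈ s := mem c39
    rw [ht] at h4
    have ht4 : t = 4 * y + 3 * 𝔫 := by
      simp only [Multiset.mem_cons, Multiset.mem_singleton] at h4
      rcases h4 with h | h | h | h
      · exact absurd h.symm (NE (by norm_num : (12:ℕ) < 48) (by norm_num : (39:ℕ) < 48) (by norm_num) T12 T39)
      · exact absurd h.symm (NE (by norm_num : (15:ℕ) < 48) (by norm_num : (39:ℕ) < 48) (by norm_num) T15 T39)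
      · exact absurd h.symm (NE (by norm_num : (27:ℕ) < 48) (by norm_num : (39:ℕ) < 48) (by norm_num) T27 T39)
      · exact h.symm
    have hs4 := hsum
    rw [ht, sum_four₇, ht4] at hs4
    exact (natMul_add_ne_zero₇ hm h3 hy3 (c := 8) (by norm_num) 3
      (by push_cast; linear_combination hs4 - h6)).elim
  · -- spurious core {y, y + 4 * 𝔫, -(y + 5 * 𝔫), 2 * y + 4 * 𝔫}: the zero sum is impossible
    obtain ⟨t, ht⟩ := exists_eq_of_three_mem₇ hcard hy (mem c16) (mem c23) (NE (by norm_num : (12:ℕ) < 48) (by norm_num : (16:ℕ) < 48) (by norm_num) T12 T16) (NE (by norm_num : (12:ℕ) < 48) (by norm_num : (23:ℕ) < 48) (by norm_num) T12 T23)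
      (NE (by norm_num : (16:ℕ) < 48) (by norm_num : (23:ℕ) < 48) (by norm_num) T16 T23)
    have h4 : 2 * y + 4 * 𝔫 ∈ s := mem c28
    rw [ht] at h4
    have ht4 : t = 2 * y + 4 * 𝔫 := by
      simp only [Multiset.mem_cons, Multiset.mem_singleton] at h4
      rcases h4 with h | h | h | h
      · exact absurd h.symm (NE (by norm_num : (12:ℕ) < 48) (by norm_num : (28:ℕ) < 48) (by norm_num) T12 T28)
      · exact absurd h.symm (NE (by norm_num : (16:ℕ) < 48) (by norm_num : (28:ℕ) < 48) (by norm_num) T16 T28)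
      · exact absurd h.symm (NE (by norm_num : (23:ℕ) < 48) (by norm_num : (28:ℕ) < 48) (by norm_num) T23 T28)
      · exact h.symm
    have hs4 := hsum
    rw [ht, sum_four₇, ht4] at hs4
    exact (three_mul_natMul_add_ne_zero₇ hm hn hk1 hy3 (c := 1) (by norm_num) 1
      (by push_cast; linear_combination hs4)).elim

/-- **The shape of a pair-free Hodge quadruple with a unit member** (`m = 2·3ᵇ`, `b ≥ 4`). `m = 6n`, `n = 3ᵏ`, `k ≥ 3`;
`s` a pair-free Hodge `4`-multiset over `ℤ/m`, `y ∈ s` a unit. Then `s` is `γ_y`, `α_y`, `β_y`, or `β_{x₀}`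
(`= {x₀, x₀ + 3n, 2x₀ + 3n = y, −4x₀ = −2y}`) for an ODD half `x₀` of `y + 3n`. PROOF: `core_of_unit_twiceThreePow` and the zero sum: in the four
genuine cores it fixes the last member; the thirteen others give `c·y + j·n = 0` or `3(c·y + j·n) = 0` with `3 ∤ c`
(impossible modulo `3`), or equate the odd `x₀` (resp. `3n`) with an even residue. [Aoki1983, Thm. C] =
[Shioda1982PicardFermat, Prop. 4 (Q′)] for the elements of `𝔅²ₘ` with a unit coordinate at these levels, by this
formalisation's route. [cite: Aoki1983, Thm. C p. 47] [cite: Shioda1982PicardFermat, Prop. 4 (Q′) p. 729]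
[cite: AokiShioda1983, §2 Thm. (𝔅²ₘ) (ii) a), b), c)] -/
theorem shape_of_unit_twiceThreePow (hm : m = 6 * n) (hn : n = 3 ^ k) (hk : 3 ≤ k) {s : Multiset (ZMod m)}
    (hs : IsHodgeMultiset s) (hcard : card s = 4) (hpf : ¬ HasPair s) {y : ZMod m} (hy : y ∈ s)
    (hy2 : ¬ 2 ∣ y.val) (hy3 : ¬ 3 ∣ y.val) :
    s = {y, y + 2 * 𝔫, y + 4 * 𝔫, -(3 * y)} ∨ s = {y, y + 3 * 𝔫, -(2 * y), 3 * 𝔫} ∨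
      s = {y, y + 3 * 𝔫, 2 * y + 3 * 𝔫, -(4 * y)} ∨
      ∃ x₀ : ZMod m, 2 * x₀ = y + 3 * 𝔫 ∧ ¬ 2 ∣ x₀.val ∧ s = {x₀, x₀ + 3 * 𝔫, 2 * x₀ + 3 * 𝔫, -(4 * x₀)} := by
  obtain ⟨x₀, hx, hx2⟩ := exists_odd_half₇ hm hn (two_dvd_val_add_three_mul_n₇ hm hn hy2)
  rcases shape_of_unit₇ hm hn hk hs hcard hpf hy hy2 hy3 hx hx2 with h | h | h | h
  · exact Or.inl h
  · exact Or.inr (Or.inl h)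
  · exact Or.inr (Or.inr (Or.inl h))
  · exact Or.inr (Or.inr (Or.inr ⟨x₀, hx, hx2, h⟩))

/-! ### No unit member -/

/-- **No unit member: everything is even** (`m = 2·3ᵇ`, `b ≥ 2`). Let `s` be a pair-free Hodge `4`-multiset over `ℤ/6n`,
`n = 3ᵏ`, `k ≥ 1`, WITHOUT unit members, and let `e ∈ s` be even and prime to `3`. Then every member of `s` is even. PROOF: for a
unit `z` the `Λ`-relation reads `o(2z) = o(2z + 4n) = o(2z + 2n)` (the unit points carry no mass); with `2z = e` (an odd half)
and pair-freeness, `e + 2n, e + 4n ∈ s`, and the zero sum gives the fourth member `−3e`. [cite: Aoki1983, Thm. C]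
[cite: AokiShioda1983, §2 Thm. (𝔅²ₘ) (ii)] -/
theorem even_of_noUnit_twiceThreePow (hm : m = 6 * n) (hn : n = 3 ^ k) (hk : 1 ≤ k) {s : Multiset (ZMod m)}
    (hs : IsHodgeMultiset s) (hcard : card s = 4) (hpf : ¬ HasPair s)
    (hnu : ∀ a ∈ s, 2 ∣ a.val ∨ 3 ∣ a.val) {e : ZMod m} (he : e ∈ s) (he2 : 2 ∣ e.val) (he3 : ¬ 3 ∣ e.val) :
    ∀ a ∈ s, 2 ∣ a.val := by
  have hn0 : 0 < n := n_pos₇ hn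
  have h3 := three_dvd_n₇ hn hk
  have h6 := six_mul_n₇ hm
  have h2m := two_dvd_m₇ hm
  have h3m := three_dvd_m₇ hm
  have hsum : s.sum = 0 := hs.1.2
  obtain ⟨z, hz, hz2⟩ := exists_odd_half₇ hm hn he2
  have hz3 : ¬ 3 ∣ z.val := fun h ↦ he3 (by rw [← hz]; exact three_dvd_val_two_mul₇ hm h)
  obtain ⟨L1, L2⟩ := lambda_class_twiceThreePow hm hn hk hs hz2 hz3 hz
  -- parities through the reduction modulo `2`
  set σ := ZMod.castHom h2m (ZMod 2) with hσ
  have σn : σ 𝔫 = 1 := by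
    have : ¬ 2 ∣ (𝔫 : ZMod m).val := by rw [val_n₇ hm hn0]; exact not_two_dvd_n₇ hn
    rw [dvd_val_iff_cast₇ h2m] at this
    have key : ∀ a : ZMod 2, a ≠ 0 → a = 1 := by decide
    exact key _ this
  have σe : σ e = 0 := (dvd_val_iff_cast₇ h2m e).mp he2
  have σz : σ z = 1 := by
    have key : ∀ a : ZMod 2, a ≠ 0 → a = 1 := by decide
    exact key _ (fun h ↦ hz2 ((dvd_val_iff_cast₇ h2m z).mpr h))
  have two2 : (2 : ZMod 2) = 0 := rfl
  have three2 : (3 : ZMod 2) = 1 := rfl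
  have four2 : (4 : ZMod 2) = 0 := rfl
  have five2 : (5 : ZMod 2) = 1 := rfl
  have odd_of : ∀ v : ZMod m, σ v = 1 → ¬ 2 ∣ v.val := fun v hv h ↦ by
    rw [dvd_val_iff_cast₇ h2m, hv] at h
    exact one_ne_zero h
  have even_of : ∀ v : ZMod m, σ v = 0 → 2 ∣ v.val := fun v hv ↦ (dvd_val_iff_cast₇ h2m v).mpr hv
  -- the unit points carry no mass
  have U : ∀ u : ZMod m, σ u = 1 → ¬ 3 ∣ u.val → count u s = 0 := fun u hu hu3 ↦
    Multiset.count_eq_zero.mpr fun hus ↦ by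
      rcases hnu u hus with h | h
      · exact odd_of u hu h
      · exact hu3 h
  have U' : ∀ u : ZMod m, σ u = 1 → ¬ 3 ∣ u.val → count u s = 0 ∧ count (-u) s = 0 := fun u hu hu3 ↦
    ⟨U u hu hu3, U (-u) (by rw [map_neg, hu]; decide) (by rwa [dvd_val_neg_iff₇ h3m])⟩
  have p3e : ∀ j : ℕ, ¬ 3 ∣ (e + ((j : ℕ) : ZMod m) * 𝔫).val := fun j ↦ prime_three_add_mul_n₇ hm h3 he3 j
  have p3z : ∀ j : ℕ, ¬ 3 ∣ (z + ((j : ℕ) : ZMod m) * 𝔫).val := fun j ↦ prime_three_add_mul_n₇ hm h3 hz3 j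
  obtain ⟨u1, u1'⟩ := U' z σz hz3
  obtain ⟨u2, u2'⟩ := U' (z + 2 * 𝔫) (by rw [_root_.map_add, _root_.map_mul, σz, σn, map_ofNat, two2]; decide)
    (by simpa using p3z 2)
  obtain ⟨u3, u3'⟩ := U' (z + 4 * 𝔫) (by rw [_root_.map_add, _root_.map_mul, σz, σn, map_ofNat, four2]; decide)
    (by simpa using p3z 4)
  obtain ⟨u4, u4'⟩ := U' (e + 3 * 𝔫) (by rw [_root_.map_add, _root_.map_mul, σe, σn, map_ofNat, three2]; decide)
    (by simpa using p3e 3)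
  obtain ⟨u5, u5'⟩ := U' (e + 𝔫) (by rw [_root_.map_add, σe, σn]; decide) (by simpa using p3e 1)
  obtain ⟨u6, u6'⟩ := U' (e + 5 * 𝔫) (by rw [_root_.map_add, _root_.map_mul, σe, σn, map_ofNat, five2]; decide)
    (by simpa using p3e 5)
  -- `o(e) = o(e + 4n) = o(e + 2n)` and pair-freeness
  have ce := Multiset.one_le_count_iff_mem.mpr he
  have cne : count (-e) s = 0 := count_neg_eq_zero_of_not_hasPair₇ hpf (ne_neg_of_prime_three₇ hm h3 he3) he
  have c4 : 1 ≤ count (e + 4 * 𝔫) s := by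
    rw [u1, u1', u2, u2', u4, u4', u5, u5'] at L1
    push_cast at L1
    omega
  have c2 : 1 ≤ count (e + 2 * 𝔫) s := by
    rw [u2, u2', u3, u3', u5, u5', u6, u6'] at L2
    push_cast at L2
    omega
  -- `s = {e, e + 2n, e + 4n, −3e}`
  have v2 : ((2 : ZMod m) * 𝔫).val = 2 * n := by simpa using val_natCast_mul_n₇ hm hn0 (j := 2) (by norm_num)
  have v4 : ((4 : ZMod m) * 𝔫).val = 4 * n := by simpa using val_natCast_mul_n₇ hm hn0 (j := 4) (by norm_num)
  have ne1 : e ≠ e + 2 * 𝔫 := by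
    intro h
    have : ((2 : ZMod m) * 𝔫).val = 0 := by rw [show (2 : ZMod m) * 𝔫 = 0 by linear_combination -h, ZMod.val_zero]
    omega
  have ne2 : e ≠ e + 4 * 𝔫 := by
    intro h
    have : ((4 : ZMod m) * 𝔫).val = 0 := by rw [show (4 : ZMod m) * 𝔫 = 0 by linear_combination -h, ZMod.val_zero]
    omega
  have ne3 : e + 2 * 𝔫 ≠ e + 4 * 𝔫 := by
    intro h
    have : ((2 : ZMod m) * 𝔫).val = 0 := by rw [show (2 : ZMod m) * 𝔫 = 0 by linear_combination -h, ZMod.val_zero]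
    omega
  obtain ⟨t, ht⟩ := exists_eq_of_three_mem₇ hcard he (Multiset.count_pos.mp (by omega)) (Multiset.count_pos.mp (by omega))
    ne1 ne2 ne3
  have hs4 := hsum
  rw [ht, sum_four₇] at hs4
  have et : t = -(3 * e) := by linear_combination hs4 - h6
  -- all four members are even
  intro a ha
  rw [ht, et] at ha
  simp only [Multiset.mem_cons, Multiset.mem_singleton] at ha
  apply even_of
  rcases ha with rfl | rfl | rfl | rfl
  · exact σe
  · rw [_root_.map_add, _root_.map_mul, σe, σn, map_ofNat, two2]; decide
  · rw [_root_.map_add, _root_.map_mul, σe, σn, map_ofNat, four2]; decide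
  · rw [map_neg, _root_.map_mul, σe, map_ofNat]; decide

end TwiceThreePow

end Literature.AlgebraicGeometry.Shioda1982
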